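import Mathlib.Algebra.Polynomial.Roots
import Literature.Analysis.FluidPDE.LuoHouSelfSimilarAnsatz
import Literature.Analysis.FluidPDE.LuoHouSeriesAnsatzEngines
import HarnessLib

/-!
# Chae–Tsai 2015, Theorem 2: the generalized (multi-order) Luo–Hou self-similar ansatz for
# 3D axisymmetric Euler is trivial

Analysis/FluidPDE proof file (theorems only: no definitions, no named facts, no `sorry`), the
continuation of `LuoHouSelfSimilarAnsatz.lean` (Chae–Tsai's Theorem 1, Sperone's Prop. 3.1; its
`TODO(general form): Thm. 2`) and of `LuoHouSeriesAnsatzEngines.lean` (the two analysis engines).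

## Source (held; `p.` = arXiv pages)

D. Chae, T.-P. Tsai, *Remark on Luo–Hou's ansatz for a self-similar solution to the 3D Euler
equations*, J. Nonlinear Sci. **25** (2015) 193–202 = arXiv:1402.4560 [`ChaeTsai2015`], §3
"Generalized self-similar ansatz" (p. 5–6):

> (11k)–(13k) `u₁ = (T−t)^{−1+γ/2} Σ_{k≥0} (T−t)^{kγ} U_k(R,Z)`,
> `ω₁ = (T−t)^{−1} Σ_{k≥0} (T−t)^{kγ} Ω_k(R,Z)`, `ψ₁ = (T−t)^{−1+2γ} Σ_{k≥0} (T−t)^{kγ} Ψ_k(R,Z)`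
> [`R = (r−1)/(T−t)^γ`, `Z = z/(T−t)^γ`]. […] since `u^r = −r∂_zψ₁` has the natural boundary
> condition `u^r = 0` at `r = 1`, it is natural to assume (Psi-BC) `∂_ZΨ|_{R=0} = 0`.
> **Theorem 2.** Let `(u₁, ω₁, ψ₁)` be a classical solution to the system (01)–(03) with the
> representation (11k)–(13k) for some `0 < γ < ∞`, in either the set `𝒞_{δ,T}` […] or in the set
> `𝒲_{δ(t)}` […]. We assume: `U_k, Ω_k, Ψ_k ∈ C¹_loc(𝒟)` ∀k; (UOPsi-infty)
> `|U_k(Y)| + |Ω_k(Y)| = o(1)`, `|∇Ψ_k(Y)| = o(|Y|)` ∀k; (Psi-BC) `∂_ZΨ_k|_{R=0} = 0` ∀k; and,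
> for some even integer `p`, (3.10) `lim_{ρ→∞} ∫_{ρ<|Y|<2ρ} (U_k^p + Ω_k^p) dY = 0` ∀ `k ≤ 1/γ`.
> Then `u₁ = ω₁ = 0` and `∇ψ₁ = 0`.

## What is typed, and how it differs from print (disclosed; never silently stronger)

`chaeTsai2015_seriesAnsatz_trivial`: the theorem on `𝒞_{δ,T}`, for ansätze with FINITELY MANY
ORDERS `k < N` (any `N`; print writes a formal series with no convergence mode —
`TODO(general form)`), profiles indexed by all `k ∈ ℕ` and zero from `N` on; `0 < γ`, `γ ≠ 2`,
and NO hypothesis (3.10): print uses (3.10) only at the resonant orders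
(`1 − γ/2 − kγ = 0` or `1 − kγ = 0`); here every resonance at an order `k ≥ 1` is settled by the
ray argument of `eq_zero_of_rayTransport` (at such an order the transport field is
`γ(Y − Y_*)` with `Y_*` on the wall, because the leading stream profile is already affine), and
the single remaining resonance — `γ = 2` at order `0`, where the field still carries `∇⊥Ψ₀` — is
EXCLUDED (`TODO(general form)`: `γ = 2` needs print's cut-off/`L^p` argument under (3.10)); Luo–Hou's
`γ ≈ 2.91` and every `γ > 2` are non-resonant. Regularity: `U_k, Ω_k ∈ C¹`, `Ψ_k ∈ C²` on an open
neighbourhood of the closed half-plane (print: `C¹_loc(𝒟̄)`, but its proof uses `ΔΨ_k` and the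
harmonicity of `∇Ψ_k` classically). The window `𝒲_{δ(t)}` is not typed. ONE PRINTED GAP is
closed, not papered over: print concludes the `Ψ₀`-step with "`Ψ₀ = aR + b`. By (UOPsi-infty),
`a = 0`", which does not follow (a constant gradient is `o(|Y|)`); instead `a = 0` follows one
order later, from the next coefficient of the stream equation,
`−ΔΨ_{k+1} − RΔΨ_k − 3∂_RΨ_k = Ω_{k+1} + RΩ_k` (`order_stream`; the `−3∂_RΨ` term of (18), cf.
`LuoHouAnsatz.substitution` clause 3), together with `|∇Ψ_{k+1}| = o(|Y|)` — this is why
`stream_affine_of_wall_of_sublinearGradient` carries a constant Laplacian `κ` and proves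
`κ = 0`. The statement of Theorem 2 is unaffected.

## Architecture (print's induction on the order, p. 5–6)

* `substitution_corr`: p555925's (16)–(18) with time-derivative corrections (the profiles of the
  partial sums depend on the scale `s = (T−t)^γ`); `hasDerivAt_series_time`: the termwise time
  derivative; `series_substitution_at_scale`: for each interior profile point `Y` and all small
  scales `s`, the three GENERATING identities (polynomial in `s`) — (28)–(30), (3.4)–(3.6) and all
  (19k)–(21k) at once.
* `order_swirl`, `order_vorticity`, `order_stream`: a real polynomial vanishing on an interval is
  zero (`Polynomial.eq_zero_of_infinite_isRoot`), and its order-`k` coefficient, read under the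
  inductive vanishing of the lower orders, is (19k)/(20k) WITH the coupling `∇⊥Ψ₀·∇` to the
  leading stream profile (absent in print's display of (19k)–(20k), harmless for the maximum
  principle, and reduced to a shift of the ray centre at resonant orders), resp. (21k).
* Induction: `U_k ≡ 0` and `Ω_k ≡ 0` by Engine A / A′; `Ψ_k` affine with the previous slope zero
  by Engine B; hence all `U_k`, `Ω_k` vanish, all `Ψ_k` are constant on `𝒟̄`, so `u₁ = ω₁ = 0`
  and `ψ₁` depends on `t` only on `𝒞_{δ,T}` (`∇ψ₁ = 0`).

## What this is NOT

Not a statement about Navier–Stokes and not a statement about Luo–Hou's or Chen–Hou's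
computations or about asymptotically self-similar blow-up: it says that an EXACT finite-order
generalized self-similar expansion in the Luo–Hou gauge, imposed on a fixed neighbourhood of the
ring together with the wall condition and the stated decay, is compatible with the axisymmetric
Euler equations only if it carries no swirl and no vorticity there — "the self-similar ansatz may
be valid either only in a time-dependent region which shrinks to the boundary circle at the
self-similar rate, or under different boundary conditions at spatial infinity of the self-similar
profile" (Chae–Tsai, abstract), at every order.

## References

* D. Chae, T.-P. Tsai, J. Nonlinear Sci. 25 (2015) 193–202, doi:10.1007/s00332-014-9225-6,
  arXiv:1402.4560: §2 (16)–(18), §3 (11k)–(13k), (3.4)–(3.6), (28)–(30), (19k)–(21k), Theorem 2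
  and its proof (arXiv p. 5–6), §4. [ChaeTsai2015]
* G. Luo, T. Y. Hou, arXiv:1310.0497, §4.7 (the numerics addressed; `γ ≈ 2.91`). [LuoHou2014]
* T. Y. Hou, arXiv:2405.10916, §2 (the `(u₁, ω₁, ψ₁)` variables = `GeneralizedAxisymNS`). [Hou2026]
-/

noncomputable section

open Set Function Filter Polynomial
open scoped Topology ContDiff

namespace Literature.Analysis.FluidPDE

namespace LuoHouSeries

/-! ### Generic lemma 1: coefficients of truncated generating polynomials -/

section Poly

/-- Evaluation of a truncated generating polynomial `Σ_{l<N} a_l X^l`. [folklore] -/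
private theorem eval_genPoly (N : ℕ) (a : ℕ → ℝ) (s : ℝ) :
    (∑ l ∈ Finset.range N, monomial l (a l)).eval s = ∑ l ∈ Finset.range N, s ^ l * a l := by
  rw [eval_finsetSum]
  refine Finset.sum_congr rfl fun l _ => ?_
  rw [eval_monomial, mul_comm]

/-- Coefficients of a truncated generating polynomial. [folklore] -/
private theorem coeff_genPoly (N : ℕ) (a : ℕ → ℝ) (m : ℕ) :
    (∑ l ∈ Finset.range N, monomial l (a l)).coeff m = if m < N then a m else 0 := by
  rw [finsetSum_coeff]
  simp_rw [coeff_monomial]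
  split_ifs with h
  · rw [Finset.sum_eq_single m]
    · simp
    · intro b _ hb; simp [hb]
    · intro hm; exact absurd (Finset.mem_range.2 h) hm
  · refine Finset.sum_eq_zero fun l hl => ?_
    have : l ≠ m := fun e => h (e ▸ Finset.mem_range.1 hl)
    simp [this]

/-- Coefficients of a truncated generating polynomial whose sequence vanishes from `N` on.
[folklore] -/
private theorem coeff_genPoly_of_vanish (N : ℕ) {a : ℕ → ℝ} (ha : ∀ l, N ≤ l → a l = 0) (m : ℕ) :
    (∑ l ∈ Finset.range N, monomial l (a l)).coeff m = a m := by
  rw [coeff_genPoly]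
  split_ifs with h
  · rfl
  · exact (ha m (not_lt.1 h)).symm

/-- **Order-`k` coefficient of a product of two truncated generating polynomials when the second
sequence vanishes below order `k`:** only the term `b₀ a_k` survives. [folklore] -/
private theorem coeff_mul_genPoly_of_vanish_lt (N : ℕ) {a b : ℕ → ℝ} (k : ℕ)
    (haN : ∀ l, N ≤ l → a l = 0) (hbN : ∀ l, N ≤ l → b l = 0) (hak : ∀ l, l < k → a l = 0) :
    ((∑ l ∈ Finset.range N, monomial l (b l)) * (∑ l ∈ Finset.range N, monomial l (a l))).coeff k
      = b 0 * a k := by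
  rw [coeff_mul]
  simp_rw [coeff_genPoly_of_vanish N hbN, coeff_genPoly_of_vanish N haN]
  rw [Finset.sum_eq_single (0, k)]
  · intro p hp hne
    have hsum : p.1 + p.2 = k := Finset.mem_antidiagonal.1 hp
    by_cases h2 : p.2 < k
    · rw [hak _ h2, mul_zero]
    · exfalso
      apply hne
      have h2' : p.2 = k := by omega
      have h1' : p.1 = 0 := by omega
      exact Prod.ext h1' h2'
  · intro h
    exact absurd (Finset.mem_antidiagonal.2 (by simp)) h

/-- Order-`k` coefficient of a product when the second sequence vanishes up to order `k`
inclusive: zero. [folklore] -/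
private theorem coeff_mul_genPoly_of_vanish_le (N : ℕ) {a b : ℕ → ℝ} (k : ℕ)
    (haN : ∀ l, N ≤ l → a l = 0) (hbN : ∀ l, N ≤ l → b l = 0) (hak : ∀ l, l ≤ k → a l = 0) :
    ((∑ l ∈ Finset.range N, monomial l (b l)) * (∑ l ∈ Finset.range N, monomial l (a l))).coeff k
      = 0 := by
  rw [coeff_mul_genPoly_of_vanish_lt N k haN hbN fun l hl => hak l hl.le, hak k le_rfl, mul_zero]

/-- `X · Q` has vanishing order-`k` coefficient when `Q` has vanishing coefficients below `k`.
[folklore] -/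
private theorem coeff_X_mul_of_vanish {Q : ℝ[X]} {k : ℕ} (h : ∀ j, j < k → Q.coeff j = 0) :
    (X * Q).coeff k = 0 := by
  cases k with
  | zero => exact coeff_X_mul_zero Q
  | succ k' => rw [coeff_X_mul]; exact h k' (Nat.lt_succ_self k')

/-- Linear recombination of finite sums (three families). [folklore] -/
private theorem sum_shape3 (N : ℕ) (f g h : ℕ → ℝ) (a b c : ℝ) :
    ∑ k ∈ Finset.range N, (a * f k + b * g k + c * h k) =
      a * (∑ k ∈ Finset.range N, f k) + b * (∑ k ∈ Finset.range N, g k) +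
        c * (∑ k ∈ Finset.range N, h k) := by
  rw [Finset.sum_add_distrib, Finset.sum_add_distrib, Finset.mul_sum, Finset.mul_sum, Finset.mul_sum]

/-- A real polynomial vanishing on a nonempty open interval is zero. [folklore] -/
private theorem poly_eq_zero_of_eval_eq_zero_Ioo {p : ℝ[X]} {a b : ℝ} (hab : a < b)
    (h : ∀ s ∈ Ioo a b, p.eval s = 0) : p = 0 :=
  p.eq_zero_of_infinite_isRoot ((Ioo_infinite hab).mono fun s hs => h s hs)

end Poly

/-! ### Private calculus on an open neighbourhood of the closed half-plane (as in the engines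
file, whose helpers are private) -/

section HalfPlaneCalculus2

variable {O : Set (ℝ × ℝ)} {G : ℝ × ℝ → ℝ} {n : WithTop ℕ∞}

/-- Differentiability at points of an open set carrying a `Cⁿ` function, `n ≠ 0`. [folklore] -/
private theorem differentiableAt_of_contDiffOn_open (hG : ContDiffOn ℝ n G O) (hO : IsOpen O)
    (hn : n ≠ 0) {Y : ℝ × ℝ} (hY : Y ∈ O) : DifferentiableAt ℝ G Y :=
  (hG.differentiableOn hn).differentiableAt (hO.mem_nhds hY)

/-- `∂_R` of a `C²` function is `C¹` on the open set. [folklore] -/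
private theorem contDiffOn_derivR_open (hG : ContDiffOn ℝ 2 G O) (hO : IsOpen O) :
    ContDiffOn ℝ 1 (derivR G) O := by
  have h : ContDiffOn ℝ 1 (fderiv ℝ G) O := hG.fderiv_of_isOpen hO le_rfl
  have e : derivR G = fun q => fderiv ℝ G q (1, 0) := funext fun q => derivR_apply G q
  rw [e]
  exact h.clm_apply contDiffOn_const

/-- `∂_Z` of a `C²` function is `C¹` on the open set. [folklore] -/
private theorem contDiffOn_derivZ_open (hG : ContDiffOn ℝ 2 G O) (hO : IsOpen O) :
    ContDiffOn ℝ 1 (derivZ G) O := by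
  have h : ContDiffOn ℝ 1 (fderiv ℝ G) O := hG.fderiv_of_isOpen hO le_rfl
  have e : derivZ G = fun q => fderiv ℝ G q (0, 1) := funext fun q => derivZ_apply G q
  rw [e]
  exact h.clm_apply contDiffOn_const

/-- `∂_R` of a `C¹` function is continuous on the open set. [folklore] -/
private theorem continuousOn_derivR_open (hG : ContDiffOn ℝ 1 G O) (hO : IsOpen O) :
    ContinuousOn (derivR G) O := by
  have h : ContinuousOn (fderiv ℝ G) O := hG.continuousOn_fderiv_of_isOpen hO le_rfl
  have e : derivR G = fun q => fderiv ℝ G q (1, 0) := funext fun q => derivR_apply G q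
  rw [e]
  exact h.clm_apply continuousOn_const

/-- `∂_Z` of a `C¹` function is continuous on the open set. [folklore] -/
private theorem continuousOn_derivZ_open (hG : ContDiffOn ℝ 1 G O) (hO : IsOpen O) :
    ContinuousOn (derivZ G) O := by
  have h : ContinuousOn (fderiv ℝ G) O := hG.continuousOn_fderiv_of_isOpen hO le_rfl
  have e : derivZ G = fun q => fderiv ℝ G q (0, 1) := funext fun q => derivZ_apply G q
  rw [e]
  exact h.clm_apply continuousOn_const

/-- `∂_R` only depends on the germ. [folklore] -/
private theorem derivR_congr_nhds {f g : ℝ × ℝ → ℝ} {Y : ℝ × ℝ} (h : f =ᶠ[𝓝 Y] g) :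
    derivR f Y = derivR g Y := by
  rw [derivR_apply, h.fderiv_eq, derivR_apply]

/-- `∂_Z` only depends on the germ. [folklore] -/
private theorem derivZ_congr_nhds {f g : ℝ × ℝ → ℝ} {Y : ℝ × ℝ} (h : f =ᶠ[𝓝 Y] g) :
    derivZ f Y = derivZ g Y := by
  rw [derivZ_apply, h.fderiv_eq, derivZ_apply]

/-- A function continuous at a wall point and constant on the open half-plane takes that value at
the wall point. [folklore] -/
private theorem eq_at_wall_of_eq_on_open {h : ℝ × ℝ → ℝ} {c : ℝ} {Z : ℝ} (hh : ContinuousAt h (0, Z))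
    (hc : ∀ Y : ℝ × ℝ, Y.1 < 0 → h Y = c) : h (0, Z) = c := by
  have hcurve : Tendsto (fun r : ℝ => ((r, Z) : ℝ × ℝ)) (𝓝[<] 0) (𝓝 (0, Z)) := by
    have : Continuous fun r : ℝ => ((r, Z) : ℝ × ℝ) := continuous_id.prodMk continuous_const
    exact (this.tendsto' 0 (0, Z) rfl).mono_left nhdsWithin_le_nhds
  have h1 : Tendsto (fun r : ℝ => h (r, Z)) (𝓝[<] 0) (𝓝 (h (0, Z))) := hh.tendsto.comp hcurve
  have h2 : Tendsto (fun r : ℝ => h (r, Z)) (𝓝[<] 0) (𝓝 c) := by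
    refine tendsto_const_nhds.congr' ?_
    filter_upwards [self_mem_nhdsWithin] with r hr
    exact (hc (r, Z) hr).symm
  exact tendsto_nhds_unique h1 h2

/-- A `C¹` function on an open neighbourhood of the closed half-plane that vanishes on the closed
half-plane has vanishing partials there. [folklore] -/
private theorem derivR_derivZ_eq_zero_of_eq_zero (hO : IsOpen O) (hHO : {Y : ℝ × ℝ | Y.1 ≤ 0} ⊆ O)
    (hG : ContDiffOn ℝ 1 G O) (h0 : ∀ Y : ℝ × ℝ, Y.1 ≤ 0 → G Y = 0) {Y : ℝ × ℝ} (hY : Y.1 ≤ 0) :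
    derivR G Y = 0 ∧ derivZ G Y = 0 := by
  have hopen : ∀ Y' : ℝ × ℝ, Y'.1 < 0 → derivR G Y' = 0 ∧ derivZ G Y' = 0 := by
    intro Y' hY'
    have hev : G =ᶠ[𝓝 Y'] fun _ => (0 : ℝ) := by
      have ho : IsOpen {q : ℝ × ℝ | q.1 < 0} := isOpen_lt continuous_fst continuous_const
      filter_upwards [ho.mem_nhds hY'] with q hq
      exact h0 q hq.le
    rw [derivR_apply, derivZ_apply, hev.fderiv_eq]
    simp
  rcases hY.lt_or_eq with hlt | heq
  · exact hopen Y hlt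
  · have hYO : Y ∈ O := hHO hY
    have hcR : ContinuousAt (derivR G) Y := (continuousOn_derivR_open hG hO).continuousAt (hO.mem_nhds hYO)
    have hcZ : ContinuousAt (derivZ G) Y := (continuousOn_derivZ_open hG hO).continuousAt (hO.mem_nhds hYO)
    have eY : Y = (0, Y.2) := by ext <;> simp [heq]
    rw [eY] at hcR hcZ ⊢
    exact ⟨eq_at_wall_of_eq_on_open hcR fun Y' h => (hopen Y' h).1,
      eq_at_wall_of_eq_on_open hcZ fun Y' h => (hopen Y' h).2⟩

end HalfPlaneCalculus2

/-! ### The substituted equations (16)–(18) for scale-dependent profiles -/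

section SubstitutionCorr

open LuoHouAnsatz

variable {S : Set ℝ} {T γ t : ℝ} {q Y : ℝ × ℝ}
  {u₁ ω₁ ψ₁ : ℝ → ℝ × ℝ → ℝ} {U Ω Ψ : ℝ × ℝ → ℝ}

/-- Power bookkeeping for `τ = T − t > 0`, `s = τ^γ`, `μ = τ^{−1−γ/2}`, `ν = τ^{−1−γ}`:
`τ^{−1+γ/2} = μ s`, `τ⁻¹ = ν s`, `τ^{−1+2γ} = ν s³`, `μ² = ν² s`. [folklore] -/
private theorem rpow_bookkeeping {τ γ : ℝ} (hτ : 0 < τ) :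
    τ ^ (-1 + γ / 2) = τ ^ (-1 - γ / 2) * τ ^ γ ∧
    τ⁻¹ = τ ^ (-1 - γ) * τ ^ γ ∧
    τ ^ (-1 + 2 * γ) = τ ^ (-1 - γ) * (τ ^ γ) ^ 3 ∧
    τ ^ (-1 - γ / 2) * τ ^ (-1 - γ / 2) = τ ^ (-1 - γ) * τ ^ (-1 - γ) * τ ^ γ := by
  refine ⟨?_, ?_, ?_, ?_⟩
  · rw [← Real.rpow_add hτ]; ring_nf
  · rw [← Real.rpow_add hτ, ← Real.rpow_neg_one]; ring_nf
  · rw [show ((τ ^ γ) ^ 3 : ℝ) = τ ^ (γ * 3) by rw [Real.rpow_mul hτ.le]; norm_num,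
      ← Real.rpow_add hτ]; ring_nf
  · rw [← Real.rpow_add hτ, ← Real.rpow_add hτ, ← Real.rpow_add hτ]; ring_nf

/-- The open left half-plane is open. [folklore] -/
private theorem isOpen_ltHalfPlane : IsOpen {Y : ℝ × ℝ | Y.1 < 0} :=
  isOpen_lt continuous_fst continuous_const

/-- **Chae–Tsai (16)–(18) with time-derivative CORRECTIONS `KU`, `KΩ`** (the form needed when the
profiles themselves depend on the scale `s = (T−t)^γ`, as the partial sums of the generalized
ansatz (11k)–(13k) do: then `∂_t` produces the extra terms `−γ Σ_k k s^k U_k`, `−γ Σ_k k s^k Ω_k`,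
entered here as `−γ·KU`, `−γ·KΩ`). Verbatim p555925 `LuoHouAnsatz.substitution` otherwise: at a
space–time point `(t, q)`, `t < T`, `q = (r, z)` with `r > 0`, let the `(u₁, ω₁, ψ₁)`-form of
the axisymmetric Euler equations hold (`GeneralizedAxisymNS S 3 0`, i.e. (01)–(03):
`u₁,t + u^r u₁,r + u^z u₁,z = 2u₁ψ₁,z`, `ω₁,t + u^r ω₁,r + u^z ω₁,z = (u₁²)_z`,
`−(∂_rr + (3/r)∂_r + ∂_zz)ψ₁ = ω₁`, `u^r = −rψ₁,z`, `u^z = 2ψ₁ + rψ₁,r`), let the slices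
`u₁(t,·), ω₁(t,·), ψ₁(t,·)` agree near `q` with Luo–Hou's ansatz (11)–(13)
`(T−t)^{−1+γ/2} U(R,Z)`, `(T−t)^{−1} Ω(R,Z)`, `(T−t)^{−1+2γ} Ψ(R,Z)`, `R = (r−1)/(T−t)^γ`,
`Z = z/(T−t)^γ`, with `C¹`/`C¹`/`C²` profiles on the left half-plane and `Y = (R, Z)` there, and
let the time derivatives at `(t, q)` be those of the ansatz. Then, with `s = (T−t)^γ`, the three
identities "leading order `+ s ·` next order `= 0`" hold at `Y`:
(16) `[(1−γ/2)U + γY·∇U + ∇⊥Ψ·∇U] + s[R ∇⊥Ψ·∇U + 2Ψ∂_ZU − 2U∂_ZΨ] = 0`,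
(17) `[Ω + γY·∇Ω + ∇⊥Ψ·∇Ω − ∂_Z(U²)] + s[R ∇⊥Ψ·∇Ω + 2Ψ∂_ZΩ] = 0`,
(18) `[−ΔΨ − Ω] + s[−RΔΨ − 3∂_RΨ − RΩ] = 0`.
[cite: ChaeTsai2015, §2 (16)–(18) (arXiv p. 4) and §3 (3.4)–(3.6), (19k)–(21k) (arXiv p. 5)] -/
theorem substitution_corr (KU KΩ : ℝ) (ht : t < T) (hq : 0 < q.1)
    (hY : Y = ((q.1 - 1) / (T - t) ^ γ, q.2 / (T - t) ^ γ)) (hY1 : Y.1 < 0)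
    (hU : ContDiffOn ℝ 1 U {Y : ℝ × ℝ | Y.1 < 0}) (hΩ : ContDiffOn ℝ 1 Ω {Y : ℝ × ℝ | Y.1 < 0})
    (hΨ : ContDiffOn ℝ 2 Ψ {Y : ℝ × ℝ | Y.1 < 0})
    (hE : GeneralizedAxisymNS S 3 0 u₁ ω₁ ψ₁ t q)
    (hu : u₁ t =ᶠ[𝓝 q] fun q' =>
      (T - t) ^ (-1 + γ / 2) * U ((q'.1 - 1) / (T - t) ^ γ, q'.2 / (T - t) ^ γ))
    (hω : ω₁ t =ᶠ[𝓝 q] fun q' =>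
      (T - t)⁻¹ * Ω ((q'.1 - 1) / (T - t) ^ γ, q'.2 / (T - t) ^ γ))
    (hψ : ψ₁ t =ᶠ[𝓝 q] fun q' =>
      (T - t) ^ (-1 + 2 * γ) * Ψ ((q'.1 - 1) / (T - t) ^ γ, q'.2 / (T - t) ^ γ))
    (hdu : timeDerivWithin S u₁ t q = (T - t) ^ (-1 + γ / 2) * (T - t)⁻¹ *
      (((1 - γ / 2) * U Y - γ * KU) + γ * (Y.1 * derivR U Y + Y.2 * derivZ U Y)))
    (hdω : timeDerivWithin S ω₁ t q = (T - t)⁻¹ * (T - t)⁻¹ *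
      ((Ω Y - γ * KΩ) + γ * (Y.1 * derivR Ω Y + Y.2 * derivZ Ω Y))) :
    (((1 - γ / 2) * U Y - γ * KU) + γ * (Y.1 * derivR U Y + Y.2 * derivZ U Y) +
        (-derivZ Ψ Y * derivR U Y + derivR Ψ Y * derivZ U Y) +
      (T - t) ^ γ * (Y.1 * (-derivZ Ψ Y * derivR U Y + derivR Ψ Y * derivZ U Y) +
        2 * Ψ Y * derivZ U Y - 2 * U Y * derivZ Ψ Y) = 0) ∧
    ((Ω Y - γ * KΩ) + γ * (Y.1 * derivR Ω Y + Y.2 * derivZ Ω Y) +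
        (-derivZ Ψ Y * derivR Ω Y + derivR Ψ Y * derivZ Ω Y) - derivZ (fun Y' => U Y' ^ 2) Y +
      (T - t) ^ γ * (Y.1 * (-derivZ Ψ Y * derivR Ω Y + derivR Ψ Y * derivZ Ω Y) +
        2 * Ψ Y * derivZ Ω Y) = 0) ∧
    (-(derivR (derivR Ψ) Y + derivZ (derivZ Ψ) Y) - Ω Y +
      (T - t) ^ γ * (-(Y.1 * (derivR (derivR Ψ) Y + derivZ (derivZ Ψ) Y)) - 3 * derivR Ψ Y -
        Y.1 * Ω Y) = 0) := by
  have hτ : 0 < T - t := sub_pos.2 ht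
  obtain ⟨hcu, hι, hcψ, hμν⟩ := rpow_bookkeeping (γ := γ) hτ
  have hs : 0 < (T - t) ^ γ := Real.rpow_pos_of_pos hτ _
  have hμ : 0 < (T - t) ^ (-1 - γ / 2) := Real.rpow_pos_of_pos hτ _
  have hν : 0 < (T - t) ^ (-1 - γ) := Real.rpow_pos_of_pos hτ _
  -- the point `Y` in the form used by the rescaling lemmas
  have hYpt : ((q.1 - 1) / (T - t) ^ γ, q.2 / (T - t) ^ γ) = Y := hY.symm
  have hq1 : q.1 = 1 + (T - t) ^ γ * Y.1 := by
    rw [hY]; simp only; field_simp; ring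
  have hY1' : (q.1 - 1) / (T - t) ^ γ < 0 := by rw [hY] at hY1; exact hY1
  -- differentiability of the profiles at `Y`
  have hUd : DifferentiableAt ℝ U ((q.1 - 1) / (T - t) ^ γ, q.2 / (T - t) ^ γ) :=
    differentiableAt_of_contDiffOn_open hU isOpen_ltHalfPlane one_ne_zero hY1'
  have hU2d : DifferentiableAt ℝ (fun Y' => U Y' ^ 2)
      ((q.1 - 1) / (T - t) ^ γ, q.2 / (T - t) ^ γ) :=
    differentiableAt_of_contDiffOn_open (hU.pow 2) isOpen_ltHalfPlane one_ne_zero hY1'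
  have hΩd : DifferentiableAt ℝ Ω ((q.1 - 1) / (T - t) ^ γ, q.2 / (T - t) ^ γ) :=
    differentiableAt_of_contDiffOn_open hΩ isOpen_ltHalfPlane one_ne_zero hY1'
  have hΨd : DifferentiableAt ℝ Ψ ((q.1 - 1) / (T - t) ^ γ, q.2 / (T - t) ^ γ) :=
    differentiableAt_of_contDiffOn_open hΨ isOpen_ltHalfPlane two_ne_zero hY1'
  -- values at `q`
  have hu0 : u₁ t q = (T - t) ^ (-1 + γ / 2) * U Y := by
    have := hu.self_of_nhds; simp only at this; rw [this, hYpt]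
  have hω0 : ω₁ t q = (T - t)⁻¹ * Ω Y := by
    have := hω.self_of_nhds; simp only at this; rw [this, hYpt]
  have hψ0 : ψ₁ t q = (T - t) ^ (-1 + 2 * γ) * Ψ Y := by
    have := hψ.self_of_nhds; simp only at this; rw [this, hYpt]
  -- first partials at `q`
  have duR := derivR_of_eventuallyEq_rescale _ hu hUd
  have duZ := derivZ_of_eventuallyEq_rescale _ hu hUd
  have dωR := derivR_of_eventuallyEq_rescale _ hω hΩd
  have dωZ := derivZ_of_eventuallyEq_rescale _ hω hΩd
  have dψR := derivR_of_eventuallyEq_rescale _ hψ hΨd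
  have dψZ := derivZ_of_eventuallyEq_rescale _ hψ hΨd
  -- second partials of `ψ₁`
  obtain ⟨dψRR, dψZZ⟩ := derivR_derivR_derivZ_derivZ_rescale _ hΨ hψ hY1'
  -- `∂_z (u₁²)`
  have hu2 : (fun q' => u₁ t q' ^ 2) =ᶠ[𝓝 q] fun q' =>
      ((T - t) ^ (-1 + γ / 2) * (T - t) ^ (-1 + γ / 2)) *
        (fun Y' => U Y' ^ 2) ((q'.1 - 1) / (T - t) ^ γ, q'.2 / (T - t) ^ γ) := by
    filter_upwards [hu] with q' hq'
    rw [hq']; ring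
  have du2Z := derivZ_of_eventuallyEq_rescale _ hu2 hU2d
  rw [hYpt] at duR duZ dωR dωZ dψR dψZ dψRR dψZZ du2Z
  -- the three equations
  have e1 := hE.swirl_eq
  have e2 := hE.vorticity_eq
  have e3 := hE.stream_eq
  simp only [GeneralizedAxisymNS.radialVel, GeneralizedAxisymNS.axialVel,
    GeneralizedAxisymNS.lap, zero_mul, add_zero] at e1 e2 e3
  rw [hdu, duR, duZ, dψR, dψZ, hu0, hψ0] at e1
  rw [hdω, dωR, dωZ, dψR, dψZ, hψ0, hω0, du2Z] at e2
  rw [dψRR, dψZZ, dψR, hω0] at e3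
  -- rewrite all powers of `T − t` in terms of `μ = τ^{−1−γ/2}`, `ν = τ^{−1−γ}`, `s = τ^γ`
  rw [hcu, hcψ, hι, hq1] at e1
  rw [hcu, hcψ, hι, hq1] at e2
  rw [hcψ, hι, hq1] at e3
  set s : ℝ := (T - t) ^ γ with hsdef
  set μ : ℝ := (T - t) ^ (-1 - γ / 2) with hμdef
  set ν : ℝ := (T - t) ^ (-1 - γ) with hνdef
  have hs0 : s ≠ 0 := hs.ne'
  have hr0 : 1 + s * Y.1 ≠ 0 := by rw [← hq1]; exact hq.ne'
  -- clear the inverse powers of `s`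
  have c1 : μ * s * s⁻¹ = μ := by field_simp
  have c2 : ν * s * s⁻¹ = ν := by field_simp
  have c3 : ν * s ^ 3 * s⁻¹ = ν * s ^ 2 := by field_simp
  have c4' : ν * s ^ 2 * s⁻¹ = ν * s := by field_simp
  have c5 : μ * s * (μ * s) * s⁻¹ = μ * μ * s := by field_simp
  simp only [c1, c2, c3, c4', c5] at e1 e2 e3
  refine ⟨?_, ?_, ?_⟩
  · have key : μ * ν * s ^ 2 * (((1 - γ / 2) * U Y - γ * KU) + γ * (Y.1 * derivR U Y + Y.2 * derivZ U Y) +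
        (-derivZ Ψ Y * derivR U Y + derivR Ψ Y * derivZ U Y) +
      s * (Y.1 * (-derivZ Ψ Y * derivR U Y + derivR Ψ Y * derivZ U Y) +
        2 * Ψ Y * derivZ U Y - 2 * U Y * derivZ Ψ Y)) = 0 := by
      linear_combination e1
    have hne : μ * ν * s ^ 2 ≠ 0 := by positivity
    exact (mul_eq_zero.1 key).resolve_left hne
  · have key : ν * ν * s ^ 2 * ((Ω Y - γ * KΩ) + γ * (Y.1 * derivR Ω Y + Y.2 * derivZ Ω Y) +
        (-derivZ Ψ Y * derivR Ω Y + derivR Ψ Y * derivZ Ω Y) - derivZ (fun Y' => U Y' ^ 2) Y +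
      s * (Y.1 * (-derivZ Ψ Y * derivR Ω Y + derivR Ψ Y * derivZ Ω Y) +
        2 * Ψ Y * derivZ Ω Y)) = 0 := by
      linear_combination e2 + (s * derivZ (fun Y' => U Y' ^ 2) Y) * hμν
    have hne : ν * ν * s ^ 2 ≠ 0 := by positivity
    exact (mul_eq_zero.1 key).resolve_left hne
  · have hρ3 : (3 : ℝ) / (1 + s * Y.1) * (1 + s * Y.1) = 3 := div_mul_cancel₀ _ hr0
    have e3' : (-(ν * s * derivR (derivR Ψ) Y + 3 / (1 + s * Y.1) * (ν * s ^ 2 * derivR Ψ Y) +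
        ν * s * derivZ (derivZ Ψ) Y)) * (1 + s * Y.1) = ν * s * Ω Y * (1 + s * Y.1) := by
      rw [e3]
    have key : ν * s * (-(derivR (derivR Ψ) Y + derivZ (derivZ Ψ) Y) - Ω Y +
      s * (-(Y.1 * (derivR (derivR Ψ) Y + derivZ (derivZ Ψ) Y)) - 3 * derivR Ψ Y -
        Y.1 * Ω Y)) = 0 := by
      linear_combination e3' + (ν * s ^ 2 * derivR Ψ Y) * hρ3
    have hne : ν * s ≠ 0 := by positivity
    exact (mul_eq_zero.1 key).resolve_left hne

end SubstitutionCorr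

/-! ### Calculus of the partial sums `Σ_{k<N} s^k G_k` of the generalized ansatz -/

section Series

open LuoHouAnsatz

variable {N : ℕ} {G : ℕ → ℝ × ℝ → ℝ}

/-- `∂_R` of a finite linear combination of profiles. [folklore] -/
private theorem derivR_finsum (c : ℕ → ℝ) {Y : ℝ × ℝ}
    (hG : ∀ k ∈ Finset.range N, DifferentiableAt ℝ (G k) Y) :
    derivR (fun q => ∑ k ∈ Finset.range N, c k * G k q) Y =
      ∑ k ∈ Finset.range N, c k * derivR (G k) Y := by
  have h : HasFDerivAt (fun q => ∑ k ∈ Finset.range N, c k * G k q)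
      (∑ k ∈ Finset.range N, c k • fderiv ℝ (G k) Y) Y :=
    HasFDerivAt.fun_sum fun k hk => ((hG k hk).hasFDerivAt.const_mul (c k))
  rw [derivR_apply, h.fderiv, FunLike.coe_sum, Finset.sum_apply]
  refine Finset.sum_congr rfl fun k _ => ?_
  rw [FunLike.coe_smul, Pi.smul_apply, derivR_apply, smul_eq_mul]

/-- `∂_Z` of a finite linear combination of profiles. [folklore] -/
private theorem derivZ_finsum (c : ℕ → ℝ) {Y : ℝ × ℝ}
    (hG : ∀ k ∈ Finset.range N, DifferentiableAt ℝ (G k) Y) :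
    derivZ (fun q => ∑ k ∈ Finset.range N, c k * G k q) Y =
      ∑ k ∈ Finset.range N, c k * derivZ (G k) Y := by
  have h : HasFDerivAt (fun q => ∑ k ∈ Finset.range N, c k * G k q)
      (∑ k ∈ Finset.range N, c k • fderiv ℝ (G k) Y) Y :=
    HasFDerivAt.fun_sum fun k hk => ((hG k hk).hasFDerivAt.const_mul (c k))
  rw [derivZ_apply, h.fderiv, FunLike.coe_sum, Finset.sum_apply]
  refine Finset.sum_congr rfl fun k _ => ?_
  rw [FunLike.coe_smul, Pi.smul_apply, derivZ_apply, smul_eq_mul]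

/-- `∂_Z (F²) = 2 F ∂_Z F`. [folklore] -/
private theorem derivZ_sq {F : ℝ × ℝ → ℝ} {Y : ℝ × ℝ} (hF : DifferentiableAt ℝ F Y) :
    derivZ (fun q => F q ^ 2) Y = 2 * F Y * derivZ F Y := by
  have h : HasFDerivAt (fun q => F q * F q) (F Y • fderiv ℝ F Y + F Y • fderiv ℝ F Y) Y :=
    hF.hasFDerivAt.mul hF.hasFDerivAt
  have e : (fun q => F q ^ 2) = fun q => F q * F q := funext fun q => sq (F q)
  rw [e, derivZ_apply, h.fderiv, derivZ_apply]
  simp only [FunLike.coe_add, Pi.add_apply, FunLike.coe_smul, Pi.smul_apply,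
    smul_eq_mul]
  ring

/-- Linear recombination of finite sums (two families). [folklore] -/
private theorem sum_shape2 (N : ℕ) (f g : ℕ → ℝ) (a b : ℝ) :
    ∑ k ∈ Finset.range N, (a * f k + b * g k) =
      a * (∑ k ∈ Finset.range N, f k) + b * (∑ k ∈ Finset.range N, g k) := by
  rw [Finset.sum_add_distrib, Finset.mul_sum, Finset.mul_sum]

/-- Linear recombination of finite sums (four families). [folklore] -/
private theorem sum_shape4 (N : ℕ) (f g h w : ℕ → ℝ) (a b c d : ℝ) :
    ∑ k ∈ Finset.range N, (a * f k + b * g k + c * h k + d * w k) =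
      a * (∑ k ∈ Finset.range N, f k) + b * (∑ k ∈ Finset.range N, g k) +
        c * (∑ k ∈ Finset.range N, h k) + d * (∑ k ∈ Finset.range N, w k) := by
  rw [Finset.sum_add_distrib, Finset.sum_add_distrib, Finset.sum_add_distrib, Finset.mul_sum,
    Finset.mul_sum, Finset.mul_sum, Finset.mul_sum]

/-- Power bookkeeping `(τ^γ)^k = τ^(γ k)` and `τ^a (τ^γ)^k = τ^(a + k γ)` for `τ > 0`. [folklore] -/
private theorem rpow_series_bookkeeping {τ : ℝ} (hτ : 0 < τ) (a γ : ℝ) (k : ℕ) :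
    τ ^ a * (τ ^ γ) ^ k = τ ^ (a + k * γ) := by
  rw [← Real.rpow_natCast (τ ^ γ) k, ← Real.rpow_mul hτ.le, Real.rpow_add hτ]
  ring_nf

/-- **Time derivative of a partial sum of the generalized ansatz**, termwise from
`LuoHouAnsatz.hasDerivAt_rescale_time`:
`∂_t [(T−t)^a Σ_k ((T−t)^γ)^k G_k(Y(t))] = (T−t)^a (T−t)⁻¹ Σ_k ((T−t)^γ)^k (−(a+kγ)G_k + γY·∇G_k)(Y)`.
[cite: ChaeTsai2015, §3 (19k)–(20k) ("the coefficients of the first terms … due to time derivatives of (T−t)^{−1+γ/2+kγ} and (T−t)^{−1+kγ}")] -/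
theorem hasDerivAt_series_time {T γ a t : ℝ} {q Y : ℝ × ℝ} (ht : t < T)
    (hY : Y = ((q.1 - 1) / (T - t) ^ γ, q.2 / (T - t) ^ γ))
    (hG : ∀ k ∈ Finset.range N, DifferentiableAt ℝ (G k) Y) :
    HasDerivAt (fun t' : ℝ => (T - t') ^ a * ∑ k ∈ Finset.range N,
        ((T - t') ^ γ) ^ k * G k ((q.1 - 1) / (T - t') ^ γ, q.2 / (T - t') ^ γ))
      ((T - t) ^ a * (T - t)⁻¹ * ∑ k ∈ Finset.range N, ((T - t) ^ γ) ^ k *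
        (-(a + k * γ) * G k Y + γ * (Y.1 * derivR (G k) Y + Y.2 * derivZ (G k) Y))) t := by
  have hτ : 0 < T - t := sub_pos.2 ht
  -- termwise derivatives with exponents `a + kγ`
  have hterm : ∀ k ∈ Finset.range N, HasDerivAt (fun t' : ℝ => (T - t') ^ (a + k * γ) *
      G k ((q.1 - 1) / (T - t') ^ γ, q.2 / (T - t') ^ γ))
      ((T - t) ^ (a + k * γ) * (T - t)⁻¹ *
        (-(a + k * γ) * G k Y + γ * (Y.1 * derivR (G k) Y + Y.2 * derivZ (G k) Y))) t :=
    fun k hk => hasDerivAt_rescale_time ht hY (hG k hk)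
  have hsum := HasDerivAt.fun_sum hterm
  -- the function agrees with the sum of the terms for `t' < T`
  have hev : (fun t' : ℝ => (T - t') ^ a * ∑ k ∈ Finset.range N,
      ((T - t') ^ γ) ^ k * G k ((q.1 - 1) / (T - t') ^ γ, q.2 / (T - t') ^ γ)) =ᶠ[𝓝 t]
      fun t' => ∑ k ∈ Finset.range N, (T - t') ^ (a + k * γ) *
        G k ((q.1 - 1) / (T - t') ^ γ, q.2 / (T - t') ^ γ) := by
    filter_upwards [Iio_mem_nhds ht] with t' ht'
    have hτ' : 0 < T - t' := sub_pos.2 ht'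
    rw [Finset.mul_sum]
    refine Finset.sum_congr rfl fun k _ => ?_
    rw [← mul_assoc, rpow_series_bookkeeping hτ' a γ k]
  refine (hsum.congr_of_eventuallyEq hev).congr_deriv ?_
  rw [Finset.mul_sum]
  refine Finset.sum_congr rfl fun k _ => ?_
  rw [← rpow_series_bookkeeping hτ a γ k]
  ring

variable {S : Set ℝ} {T γ δ : ℝ} {u₁ ω₁ ψ₁ : ℝ → ℝ × ℝ → ℝ} {U Ω Ψ : ℕ → ℝ × ℝ → ℝ}
  {O : Set (ℝ × ℝ)}

/-- **All orders of Chae–Tsai's substituted equations for the generalized ansatz, at a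
prescribed scale.** Under the finite-order ansatz (11k)–(13k) on `𝒞_{δ,T}` with the
`(u₁, ω₁, ψ₁)` Euler equations there, for every profile point `Y = (R, Z)`, `R < 0`, and every
admissible scale `s` (as in `LuoHouAnsatz.substitution_at_scale`), the three identities
(16)–(18) hold for the partial sums `Σ_k s^k U_k`, `Σ_k s^k Ω_k`, `Σ_k s^k Ψ_k` with the
time-derivative corrections `−γ Σ_k k s^k U_k`, `−γ Σ_k k s^k Ω_k` — i.e. the generating form of
(28)–(30), (3.4)–(3.6) and all higher orders (19k)–(21k) at once.
[cite: ChaeTsai2015, §3 (11k)–(13k), (3.4)–(3.6), (28)–(30), (19k)–(21k) (arXiv p. 5)] -/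
theorem series_substitution_at_scale (hγ : 0 < γ) (hS : Ioo (T - δ) T ⊆ S)
    (hO : IsOpen O) (hHO : {Y : ℝ × ℝ | Y.1 ≤ 0} ⊆ O)
    (hU : ∀ k, ContDiffOn ℝ 1 (U k) O) (hΩ : ∀ k, ContDiffOn ℝ 1 (Ω k) O)
    (hΨ : ∀ k, ContDiffOn ℝ 2 (Ψ k) O)
    (hE : ∀ t ∈ Ioo (T - δ) T, ∀ q : ℝ × ℝ, 1 - δ < q.1 → q.1 < 1 → |q.2| < δ →
      GeneralizedAxisymNS S 3 0 u₁ ω₁ ψ₁ t q)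
    (hu : ∀ t ∈ Ioo (T - δ) T, ∀ q : ℝ × ℝ, 1 - δ < q.1 → q.1 < 1 → |q.2| < δ →
      u₁ t q = (T - t) ^ (-1 + γ / 2) * ∑ k ∈ Finset.range N,
        ((T - t) ^ γ) ^ k * U k ((q.1 - 1) / (T - t) ^ γ, q.2 / (T - t) ^ γ))
    (hω : ∀ t ∈ Ioo (T - δ) T, ∀ q : ℝ × ℝ, 1 - δ < q.1 → q.1 < 1 → |q.2| < δ →
      ω₁ t q = (T - t)⁻¹ * ∑ k ∈ Finset.range N,
        ((T - t) ^ γ) ^ k * Ω k ((q.1 - 1) / (T - t) ^ γ, q.2 / (T - t) ^ γ))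
    (hψ : ∀ t ∈ Ioo (T - δ) T, ∀ q : ℝ × ℝ, 1 - δ < q.1 → q.1 < 1 → |q.2| < δ →
      ψ₁ t q = (T - t) ^ (-1 + 2 * γ) * ∑ k ∈ Finset.range N,
        ((T - t) ^ γ) ^ k * Ψ k ((q.1 - 1) / (T - t) ^ γ, q.2 / (T - t) ^ γ))
    {Y : ℝ × ℝ} (hY1 : Y.1 < 0) {s : ℝ} (hs : 0 < s) (hsδ : s ^ γ⁻¹ < δ)
    (hsY1 : s * |Y.1| < min δ 1) (hsY2 : s * |Y.2| < δ) :
    ((∑ k ∈ Finset.range N, s ^ k * ((1 - γ / 2 - k * γ) * U k Y)) +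
        γ * (Y.1 * (∑ k ∈ Finset.range N, s ^ k * derivR (U k) Y) +
          Y.2 * (∑ k ∈ Finset.range N, s ^ k * derivZ (U k) Y)) +
        (-(∑ k ∈ Finset.range N, s ^ k * derivZ (Ψ k) Y) *
            (∑ k ∈ Finset.range N, s ^ k * derivR (U k) Y) +
          (∑ k ∈ Finset.range N, s ^ k * derivR (Ψ k) Y) *
            (∑ k ∈ Finset.range N, s ^ k * derivZ (U k) Y)) +
      s * (Y.1 * (-(∑ k ∈ Finset.range N, s ^ k * derivZ (Ψ k) Y) *
            (∑ k ∈ Finset.range N, s ^ k * derivR (U k) Y) +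
          (∑ k ∈ Finset.range N, s ^ k * derivR (Ψ k) Y) *
            (∑ k ∈ Finset.range N, s ^ k * derivZ (U k) Y)) +
        2 * (∑ k ∈ Finset.range N, s ^ k * Ψ k Y) *
          (∑ k ∈ Finset.range N, s ^ k * derivZ (U k) Y) -
        2 * (∑ k ∈ Finset.range N, s ^ k * U k Y) *
          (∑ k ∈ Finset.range N, s ^ k * derivZ (Ψ k) Y)) = 0) ∧
    ((∑ k ∈ Finset.range N, s ^ k * ((1 - k * γ) * Ω k Y)) +
        γ * (Y.1 * (∑ k ∈ Finset.range N, s ^ k * derivR (Ω k) Y) +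
          Y.2 * (∑ k ∈ Finset.range N, s ^ k * derivZ (Ω k) Y)) +
        (-(∑ k ∈ Finset.range N, s ^ k * derivZ (Ψ k) Y) *
            (∑ k ∈ Finset.range N, s ^ k * derivR (Ω k) Y) +
          (∑ k ∈ Finset.range N, s ^ k * derivR (Ψ k) Y) *
            (∑ k ∈ Finset.range N, s ^ k * derivZ (Ω k) Y)) -
        2 * (∑ k ∈ Finset.range N, s ^ k * U k Y) *
          (∑ k ∈ Finset.range N, s ^ k * derivZ (U k) Y) +
      s * (Y.1 * (-(∑ k ∈ Finset.range N, s ^ k * derivZ (Ψ k) Y) *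
            (∑ k ∈ Finset.range N, s ^ k * derivR (Ω k) Y) +
          (∑ k ∈ Finset.range N, s ^ k * derivR (Ψ k) Y) *
            (∑ k ∈ Finset.range N, s ^ k * derivZ (Ω k) Y)) +
        2 * (∑ k ∈ Finset.range N, s ^ k * Ψ k Y) *
          (∑ k ∈ Finset.range N, s ^ k * derivZ (Ω k) Y)) = 0) ∧
    (-(∑ k ∈ Finset.range N, s ^ k * (derivR (derivR (Ψ k)) Y + derivZ (derivZ (Ψ k)) Y)) -
        (∑ k ∈ Finset.range N, s ^ k * Ω k Y) +
      s * (-(Y.1 * (∑ k ∈ Finset.range N, s ^ k *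
          (derivR (derivR (Ψ k)) Y + derivZ (derivZ (Ψ k)) Y))) -
        3 * (∑ k ∈ Finset.range N, s ^ k * derivR (Ψ k) Y) -
        Y.1 * (∑ k ∈ Finset.range N, s ^ k * Ω k Y)) = 0) := by
  -- the partial sums as profiles on the open left half-plane
  have hlt : {Y : ℝ × ℝ | Y.1 < 0} ⊆ O := fun Y' hY' => hHO (show Y'.1 ≤ 0 from le_of_lt hY')
  set Us : ℝ × ℝ → ℝ := fun q => ∑ k ∈ Finset.range N, s ^ k * U k q with hUs
  set Ωs : ℝ × ℝ → ℝ := fun q => ∑ k ∈ Finset.range N, s ^ k * Ω k q with hΩs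
  set Ψs : ℝ × ℝ → ℝ := fun q => ∑ k ∈ Finset.range N, s ^ k * Ψ k q with hΨs
  have hUs1 : ContDiffOn ℝ 1 Us {Y : ℝ × ℝ | Y.1 < 0} :=
    ContDiffOn.sum fun k _ => ((contDiffOn_const).mul ((hU k).mono hlt))
  have hΩs1 : ContDiffOn ℝ 1 Ωs {Y : ℝ × ℝ | Y.1 < 0} :=
    ContDiffOn.sum fun k _ => ((contDiffOn_const).mul ((hΩ k).mono hlt))
  have hΨs2 : ContDiffOn ℝ 2 Ψs {Y : ℝ × ℝ | Y.1 < 0} :=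
    ContDiffOn.sum fun k _ => ((contDiffOn_const).mul ((hΨ k).mono hlt))
  -- the time `t = T − s^{1/γ}` and the point `q = (1 + sR, sZ)` (as in `substitution_at_scale`)
  set τ : ℝ := s ^ γ⁻¹ with hτdef
  have hτ : 0 < τ := Real.rpow_pos_of_pos hs _
  set t : ℝ := T - τ with htdef
  have hTt : T - t = τ := by rw [htdef]; ring
  have hτγ : (T - t) ^ γ = s := by
    rw [hTt, hτdef, ← Real.rpow_mul hs.le, inv_mul_cancel₀ hγ.ne', Real.rpow_one]
  have ht : t ∈ Ioo (T - δ) T := ⟨by rw [htdef]; linarith, by rw [htdef]; linarith⟩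
  have htT : t < T := ht.2
  set q : ℝ × ℝ := (1 + s * Y.1, s * Y.2) with hqdef
  have hY1abs : |Y.1| = -Y.1 := abs_of_neg hY1
  have hq1lt : q.1 < 1 := by
    show 1 + s * Y.1 < 1
    nlinarith
  have hq1gt : 1 - δ < q.1 := by
    show 1 - δ < 1 + s * Y.1
    have := lt_of_lt_of_le hsY1 (min_le_left _ _)
    rw [hY1abs] at this; linarith
  have hq1pos : 0 < q.1 := by
    show 0 < 1 + s * Y.1
    have := lt_of_lt_of_le hsY1 (min_le_right _ _)
    rw [hY1abs] at this; linarith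
  have hq2 : |q.2| < δ := by
    show |s * Y.2| < δ
    rwa [abs_mul, abs_of_pos hs]
  have hYq : Y = ((q.1 - 1) / (T - t) ^ γ, q.2 / (T - t) ^ γ) := by
    rw [hτγ]
    ext
    · show Y.1 = (1 + s * Y.1 - 1) / s
      field_simp; ring
    · show Y.2 = s * Y.2 / s
      field_simp
  -- the spatial region is a neighbourhood of `q`
  have hreg : ∀ᶠ q' : ℝ × ℝ in 𝓝 q, 1 - δ < q'.1 ∧ q'.1 < 1 ∧ |q'.2| < δ := by
    have ho : IsOpen {q' : ℝ × ℝ | 1 - δ < q'.1 ∧ q'.1 < 1 ∧ |q'.2| < δ} :=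
      (isOpen_lt continuous_const continuous_fst).inter
        ((isOpen_lt continuous_fst continuous_const).inter
          (isOpen_lt (continuous_abs.comp continuous_snd) continuous_const))
    exact ho.mem_nhds ⟨hq1gt, hq1lt, hq2⟩
  have hu' : u₁ t =ᶠ[𝓝 q] fun q' =>
      (T - t) ^ (-1 + γ / 2) * Us ((q'.1 - 1) / (T - t) ^ γ, q'.2 / (T - t) ^ γ) :=
    hreg.mono fun q' hq' => by rw [hu t ht q' hq'.1 hq'.2.1 hq'.2.2, hUs, hτγ]
  have hω' : ω₁ t =ᶠ[𝓝 q] fun q' =>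
      (T - t)⁻¹ * Ωs ((q'.1 - 1) / (T - t) ^ γ, q'.2 / (T - t) ^ γ) :=
    hreg.mono fun q' hq' => by rw [hω t ht q' hq'.1 hq'.2.1 hq'.2.2, hΩs, hτγ]
  have hψ' : ψ₁ t =ᶠ[𝓝 q] fun q' =>
      (T - t) ^ (-1 + 2 * γ) * Ψs ((q'.1 - 1) / (T - t) ^ γ, q'.2 / (T - t) ^ γ) :=
    hreg.mono fun q' hq' => by rw [hψ t ht q' hq'.1 hq'.2.1 hq'.2.2, hΨs, hτγ]
  -- differentiability of the individual profiles at `Y`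
  have hYO : Y ∈ O := hHO hY1.le
  have dU : ∀ k ∈ Finset.range N, DifferentiableAt ℝ (U k) Y := fun k _ =>
    differentiableAt_of_contDiffOn_open (hU k) hO one_ne_zero hYO
  have dΩ : ∀ k ∈ Finset.range N, DifferentiableAt ℝ (Ω k) Y := fun k _ =>
    differentiableAt_of_contDiffOn_open (hΩ k) hO one_ne_zero hYO
  have dΨ : ∀ k ∈ Finset.range N, DifferentiableAt ℝ (Ψ k) Y := fun k _ =>
    differentiableAt_of_contDiffOn_open (hΨ k) hO two_ne_zero hYO
  -- first partials of the partial sums at `Y`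
  have eUsR : derivR Us Y = ∑ k ∈ Finset.range N, s ^ k * derivR (U k) Y :=
    derivR_finsum (fun k => s ^ k) dU
  have eUsZ : derivZ Us Y = ∑ k ∈ Finset.range N, s ^ k * derivZ (U k) Y :=
    derivZ_finsum (fun k => s ^ k) dU
  have eΩsR : derivR Ωs Y = ∑ k ∈ Finset.range N, s ^ k * derivR (Ω k) Y :=
    derivR_finsum (fun k => s ^ k) dΩ
  have eΩsZ : derivZ Ωs Y = ∑ k ∈ Finset.range N, s ^ k * derivZ (Ω k) Y :=
    derivZ_finsum (fun k => s ^ k) dΩ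
  have eΨsR : derivR Ψs Y = ∑ k ∈ Finset.range N, s ^ k * derivR (Ψ k) Y :=
    derivR_finsum (fun k => s ^ k) dΨ
  have eΨsZ : derivZ Ψs Y = ∑ k ∈ Finset.range N, s ^ k * derivZ (Ψ k) Y :=
    derivZ_finsum (fun k => s ^ k) dΨ
  -- second partials of `Ψs` at `Y` (the first partials are sums near `Y`)
  have evΨsR : derivR Ψs =ᶠ[𝓝 Y] fun q => ∑ k ∈ Finset.range N, s ^ k * derivR (Ψ k) q := by
    filter_upwards [hO.mem_nhds hYO] with q hq
    exact derivR_finsum (fun k => s ^ k) fun k _ =>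
      differentiableAt_of_contDiffOn_open (hΨ k) hO two_ne_zero hq
  have evΨsZ : derivZ Ψs =ᶠ[𝓝 Y] fun q => ∑ k ∈ Finset.range N, s ^ k * derivZ (Ψ k) q := by
    filter_upwards [hO.mem_nhds hYO] with q hq
    exact derivZ_finsum (fun k => s ^ k) fun k _ =>
      differentiableAt_of_contDiffOn_open (hΨ k) hO two_ne_zero hq
  have eΨsRR : derivR (derivR Ψs) Y = ∑ k ∈ Finset.range N, s ^ k * derivR (derivR (Ψ k)) Y := by
    rw [derivR_congr_nhds evΨsR]
    exact derivR_finsum (fun k => s ^ k) fun k _ =>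
      differentiableAt_of_contDiffOn_open (contDiffOn_derivR_open (hΨ k) hO) hO one_ne_zero hYO
  have eΨsZZ : derivZ (derivZ Ψs) Y = ∑ k ∈ Finset.range N, s ^ k * derivZ (derivZ (Ψ k)) Y := by
    rw [derivZ_congr_nhds evΨsZ]
    exact derivZ_finsum (fun k => s ^ k) fun k _ =>
      differentiableAt_of_contDiffOn_open (contDiffOn_derivZ_open (hΨ k) hO) hO one_ne_zero hYO
  have hUsd : DifferentiableAt ℝ Us Y :=
    differentiableAt_of_contDiffOn_open hUs1 isOpen_ltHalfPlane one_ne_zero hY1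
  have eUs2Z : derivZ (fun Y' => Us Y' ^ 2) Y =
      2 * (∑ k ∈ Finset.range N, s ^ k * U k Y) * (∑ k ∈ Finset.range N, s ^ k * derivZ (U k) Y) := by
    rw [derivZ_sq hUsd, eUsZ]
  -- time derivatives of the series at `(t, q)`
  have hSt : S ∈ 𝓝 t := Filter.mem_of_superset (isOpen_Ioo.mem_nhds ht) hS
  have hdu : timeDerivWithin S u₁ t q = (T - t) ^ (-1 + γ / 2) * (T - t)⁻¹ *
      (((1 - γ / 2) * Us Y - γ * (∑ k ∈ Finset.range N, s ^ k * (k * U k Y))) +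
        γ * (Y.1 * derivR Us Y + Y.2 * derivZ Us Y)) := by
    rw [timeDerivWithin_apply, derivWithin_of_mem_nhds hSt]
    have hev : (fun t' => u₁ t' q) =ᶠ[𝓝 t] fun t' => (T - t') ^ (-1 + γ / 2) *
        ∑ k ∈ Finset.range N, ((T - t') ^ γ) ^ k *
          U k ((q.1 - 1) / (T - t') ^ γ, q.2 / (T - t') ^ γ) :=
      Filter.eventuallyEq_of_mem (isOpen_Ioo.mem_nhds ht) fun t' ht' =>
        hu t' ht' q hq1gt hq1lt hq2
    rw [hev.deriv_eq, (hasDerivAt_series_time (a := -1 + γ / 2) htT hYq (hYq ▸ dU)).deriv, hτγ,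
      eUsR, eUsZ, hUs]
    have key : ∑ k ∈ Finset.range N, s ^ k * (-(-1 + γ / 2 + k * γ) * U k Y +
        γ * (Y.1 * derivR (U k) Y + Y.2 * derivZ (U k) Y)) =
        (1 - γ / 2) * (∑ k ∈ Finset.range N, s ^ k * U k Y) +
        (-γ) * (∑ k ∈ Finset.range N, s ^ k * (k * U k Y)) +
        γ * Y.1 * (∑ k ∈ Finset.range N, s ^ k * derivR (U k) Y) +
        γ * Y.2 * (∑ k ∈ Finset.range N, s ^ k * derivZ (U k) Y) := by
      rw [← sum_shape4]
      exact Finset.sum_congr rfl fun k _ => by ring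
    simp only
    rw [key]; ring
  have hdω : timeDerivWithin S ω₁ t q = (T - t)⁻¹ * (T - t)⁻¹ *
      ((Ωs Y - γ * (∑ k ∈ Finset.range N, s ^ k * (k * Ω k Y))) +
        γ * (Y.1 * derivR Ωs Y + Y.2 * derivZ Ωs Y)) := by
    rw [timeDerivWithin_apply, derivWithin_of_mem_nhds hSt]
    have hev : (fun t' => ω₁ t' q) =ᶠ[𝓝 t] fun t' => (T - t') ^ (-1 : ℝ) *
        ∑ k ∈ Finset.range N, ((T - t') ^ γ) ^ k *
          Ω k ((q.1 - 1) / (T - t') ^ γ, q.2 / (T - t') ^ γ) :=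
      Filter.eventuallyEq_of_mem (isOpen_Ioo.mem_nhds ht) fun t' ht' => by
        rw [hω t' ht' q hq1gt hq1lt hq2, Real.rpow_neg_one]
    rw [hev.deriv_eq, (hasDerivAt_series_time (a := -1) htT hYq (hYq ▸ dΩ)).deriv,
      Real.rpow_neg_one, hτγ, eΩsR, eΩsZ, hΩs]
    have key : ∑ k ∈ Finset.range N, s ^ k * (-(-1 + k * γ) * Ω k Y +
        γ * (Y.1 * derivR (Ω k) Y + Y.2 * derivZ (Ω k) Y)) =
        (1 : ℝ) * (∑ k ∈ Finset.range N, s ^ k * Ω k Y) +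
        (-γ) * (∑ k ∈ Finset.range N, s ^ k * (k * Ω k Y)) +
        γ * Y.1 * (∑ k ∈ Finset.range N, s ^ k * derivR (Ω k) Y) +
        γ * Y.2 * (∑ k ∈ Finset.range N, s ^ k * derivZ (Ω k) Y) := by
      rw [← sum_shape4]
      exact Finset.sum_congr rfl fun k _ => by ring
    simp only
    rw [key]; ring
  have h := substitution_corr (∑ k ∈ Finset.range N, s ^ k * (k * U k Y))
    (∑ k ∈ Finset.range N, s ^ k * (k * Ω k Y)) htT hq1pos hYq hY1 hUs1 hΩs1 hΨs2
    (hE t ht q hq1gt hq1lt hq2) hu' hω' hψ' hdu hdω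
  rw [hτγ, eUsR, eUsZ, eΩsR, eΩsZ, eΨsR, eΨsZ, eΨsRR, eΨsZZ, eUs2Z] at h
  simp only [hUs, hΩs, hΨs] at h
  obtain ⟨h1, h2, h3⟩ := h
  have e2 : ∑ k ∈ Finset.range N, s ^ k * ((1 - γ / 2 - k * γ) * U k Y) =
      (1 - γ / 2) * (∑ k ∈ Finset.range N, s ^ k * U k Y) +
        (-γ) * (∑ k ∈ Finset.range N, s ^ k * (k * U k Y)) := by
    rw [← sum_shape2]
    exact Finset.sum_congr rfl fun k _ => by ring
  have e3 : ∑ k ∈ Finset.range N, s ^ k * ((1 - k * γ) * Ω k Y) =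
      (1 : ℝ) * (∑ k ∈ Finset.range N, s ^ k * Ω k Y) +
        (-γ) * (∑ k ∈ Finset.range N, s ^ k * (k * Ω k Y)) := by
    rw [← sum_shape2]
    exact Finset.sum_congr rfl fun k _ => by ring
  have e4 : ∑ k ∈ Finset.range N, s ^ k * (derivR (derivR (Ψ k)) Y + derivZ (derivZ (Ψ k)) Y) =
      (1 : ℝ) * (∑ k ∈ Finset.range N, s ^ k * derivR (derivR (Ψ k)) Y) +
        1 * (∑ k ∈ Finset.range N, s ^ k * derivZ (derivZ (Ψ k)) Y) := by
    rw [← sum_shape2]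
    exact Finset.sum_congr rfl fun k _ => by ring
  refine ⟨?_, ?_, ?_⟩
  · linear_combination h1 + e2
  · linear_combination h2 + e3
  · linear_combination h3 - (1 + s * Y.1) * e4

end Series

/-! ### Reading off the order-`k` equations (19k)–(21k) from the generating identities -/

section Orders

variable {N : ℕ} {U Ω Ψ : ℕ → ℝ × ℝ → ℝ} {γ : ℝ} {Y : ℝ × ℝ} {s₀ : ℝ}

/-- **The order-`k` swirl equation (19k), with its coupling to the leading stream profile.**
If the generating swirl identity holds at `Y` for all small scales `s`, the profiles vanish from
order `N` on, and `U_l` together with its gradient vanishes at `Y` for `l < k`, then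
`(1 − γ/2 − kγ)U_k + γY·∇U_k + ∇⊥Ψ₀·∇U_k = 0` at `Y`.
[cite: ChaeTsai2015, §3 (28), (3.4), (19k) (arXiv p. 5)] -/
theorem order_swirl (hs₀ : 0 < s₀)
    (hid : ∀ s ∈ Ioo 0 s₀,
      (∑ k ∈ Finset.range N, s ^ k * ((1 - γ / 2 - k * γ) * U k Y)) +
        γ * (Y.1 * (∑ k ∈ Finset.range N, s ^ k * derivR (U k) Y) +
          Y.2 * (∑ k ∈ Finset.range N, s ^ k * derivZ (U k) Y)) +
        (-(∑ k ∈ Finset.range N, s ^ k * derivZ (Ψ k) Y) *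
            (∑ k ∈ Finset.range N, s ^ k * derivR (U k) Y) +
          (∑ k ∈ Finset.range N, s ^ k * derivR (Ψ k) Y) *
            (∑ k ∈ Finset.range N, s ^ k * derivZ (U k) Y)) +
      s * (Y.1 * (-(∑ k ∈ Finset.range N, s ^ k * derivZ (Ψ k) Y) *
            (∑ k ∈ Finset.range N, s ^ k * derivR (U k) Y) +
          (∑ k ∈ Finset.range N, s ^ k * derivR (Ψ k) Y) *
            (∑ k ∈ Finset.range N, s ^ k * derivZ (U k) Y)) +
        2 * (∑ k ∈ Finset.range N, s ^ k * Ψ k Y) *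
          (∑ k ∈ Finset.range N, s ^ k * derivZ (U k) Y) -
        2 * (∑ k ∈ Finset.range N, s ^ k * U k Y) *
          (∑ k ∈ Finset.range N, s ^ k * derivZ (Ψ k) Y)) = 0)
    (k : ℕ) (hUN : ∀ l, N ≤ l → U l Y = 0 ∧ derivR (U l) Y = 0 ∧ derivZ (U l) Y = 0)
    (hΨN : ∀ l, N ≤ l → Ψ l Y = 0 ∧ derivR (Ψ l) Y = 0 ∧ derivZ (Ψ l) Y = 0)
    (hUk : ∀ l, l < k → U l Y = 0 ∧ derivR (U l) Y = 0 ∧ derivZ (U l) Y = 0) :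
    (1 - γ / 2 - k * γ) * U k Y + γ * (Y.1 * derivR (U k) Y + Y.2 * derivZ (U k) Y) +
      (-derivZ (Ψ 0) Y * derivR (U k) Y + derivR (Ψ 0) Y * derivZ (U k) Y) = 0 := by
  -- the generating polynomials at `Y`
  set PU : ℝ[X] := ∑ l ∈ Finset.range N, monomial l (U l Y) with hPU
  set PRU : ℝ[X] := ∑ l ∈ Finset.range N, monomial l (derivR (U l) Y) with hPRU
  set PZU : ℝ[X] := ∑ l ∈ Finset.range N, monomial l (derivZ (U l) Y) with hPZU
  set PΨ : ℝ[X] := ∑ l ∈ Finset.range N, monomial l (Ψ l Y) with hPΨ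
  set PRΨ : ℝ[X] := ∑ l ∈ Finset.range N, monomial l (derivR (Ψ l) Y) with hPRΨ
  set PZΨ : ℝ[X] := ∑ l ∈ Finset.range N, monomial l (derivZ (Ψ l) Y) with hPZΨ
  set AU : ℝ[X] := ∑ l ∈ Finset.range N, monomial l ((1 - γ / 2 - l * γ) * U l Y +
    γ * (Y.1 * derivR (U l) Y + Y.2 * derivZ (U l) Y)) with hAU
  set P : ℝ[X] := AU + (1 + C Y.1 * X) * (-PZΨ * PRU + PRΨ * PZU) +
    C 2 * X * (PΨ * PZU - PU * PZΨ) with hP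
  -- its evaluation is the generating identity
  have heval : ∀ s : ℝ, P.eval s =
      (∑ k ∈ Finset.range N, s ^ k * ((1 - γ / 2 - k * γ) * U k Y)) +
        γ * (Y.1 * (∑ k ∈ Finset.range N, s ^ k * derivR (U k) Y) +
          Y.2 * (∑ k ∈ Finset.range N, s ^ k * derivZ (U k) Y)) +
        (-(∑ k ∈ Finset.range N, s ^ k * derivZ (Ψ k) Y) *
            (∑ k ∈ Finset.range N, s ^ k * derivR (U k) Y) +
          (∑ k ∈ Finset.range N, s ^ k * derivR (Ψ k) Y) *
            (∑ k ∈ Finset.range N, s ^ k * derivZ (U k) Y)) +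
      s * (Y.1 * (-(∑ k ∈ Finset.range N, s ^ k * derivZ (Ψ k) Y) *
            (∑ k ∈ Finset.range N, s ^ k * derivR (U k) Y) +
          (∑ k ∈ Finset.range N, s ^ k * derivR (Ψ k) Y) *
            (∑ k ∈ Finset.range N, s ^ k * derivZ (U k) Y)) +
        2 * (∑ k ∈ Finset.range N, s ^ k * Ψ k Y) *
          (∑ k ∈ Finset.range N, s ^ k * derivZ (U k) Y) -
        2 * (∑ k ∈ Finset.range N, s ^ k * U k Y) *
          (∑ k ∈ Finset.range N, s ^ k * derivZ (Ψ k) Y)) := by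
    intro s
    have eA : AU.eval s = (1 : ℝ) * (∑ k ∈ Finset.range N, s ^ k * ((1 - γ / 2 - k * γ) * U k Y)) +
        γ * Y.1 * (∑ k ∈ Finset.range N, s ^ k * derivR (U k) Y) +
        γ * Y.2 * (∑ k ∈ Finset.range N, s ^ k * derivZ (U k) Y) := by
      rw [hAU, eval_genPoly, ← sum_shape3]
      exact Finset.sum_congr rfl fun k _ => by ring
    simp only [hP, eval_add, eval_mul, eval_sub, eval_neg, eval_C, eval_X, eval_one,
      hPU, hPRU, hPZU, hPΨ, hPRΨ, hPZΨ, eval_genPoly]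
    rw [eA]; ring
  -- hence it is the zero polynomial
  have hP0 : P = 0 :=
    poly_eq_zero_of_eval_eq_zero_Ioo hs₀ fun s hs => by rw [heval s]; exact hid s hs
  have hcoeff : P.coeff k = 0 := by rw [hP0, coeff_zero]
  -- read off the order-`k` coefficient
  have vRU : ∀ l, l < k → derivR (U l) Y = 0 := fun l hl => (hUk l hl).2.1
  have vZU : ∀ l, l < k → derivZ (U l) Y = 0 := fun l hl => (hUk l hl).2.2
  have vU : ∀ l, l < k → U l Y = 0 := fun l hl => (hUk l hl).1
  have nU : ∀ l, N ≤ l → U l Y = 0 := fun l hl => (hUN l hl).1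
  have nRU : ∀ l, N ≤ l → derivR (U l) Y = 0 := fun l hl => (hUN l hl).2.1
  have nZU : ∀ l, N ≤ l → derivZ (U l) Y = 0 := fun l hl => (hUN l hl).2.2
  have nΨ : ∀ l, N ≤ l → Ψ l Y = 0 := fun l hl => (hΨN l hl).1
  have nRΨ : ∀ l, N ≤ l → derivR (Ψ l) Y = 0 := fun l hl => (hΨN l hl).2.1
  have nZΨ : ∀ l, N ≤ l → derivZ (Ψ l) Y = 0 := fun l hl => (hΨN l hl).2.2
  have cA : AU.coeff k = (1 - γ / 2 - k * γ) * U k Y +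
      γ * (Y.1 * derivR (U k) Y + Y.2 * derivZ (U k) Y) := by
    rw [hAU, coeff_genPoly_of_vanish N]
    intro l hl
    rw [nU l hl, nRU l hl, nZU l hl]; ring
  set Q : ℝ[X] := -PZΨ * PRU + PRΨ * PZU with hQ
  have cQ : Q.coeff k = -(derivZ (Ψ 0) Y * derivR (U k) Y) + derivR (Ψ 0) Y * derivZ (U k) Y := by
    rw [hQ, coeff_add, neg_mul, coeff_neg, hPZΨ, hPRU, hPRΨ, hPZU,
      coeff_mul_genPoly_of_vanish_lt N k nRU nZΨ vRU, coeff_mul_genPoly_of_vanish_lt N k nZU nRΨ vZU]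
  have cQlow : ∀ j, j < k → Q.coeff j = 0 := by
    intro j hj
    rw [hQ, coeff_add, neg_mul, coeff_neg, hPZΨ, hPRU, hPRΨ, hPZU,
      coeff_mul_genPoly_of_vanish_le N j nRU nZΨ (fun l hl => vRU l (lt_of_le_of_lt hl hj)),
      coeff_mul_genPoly_of_vanish_le N j nZU nRΨ (fun l hl => vZU l (lt_of_le_of_lt hl hj))]
    ring
  have c2 : ((1 + C Y.1 * X) * Q).coeff k = Q.coeff k := by
    rw [add_mul, one_mul, coeff_add, mul_assoc, coeff_C_mul, coeff_X_mul_of_vanish cQlow]; ring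
  set Q' : ℝ[X] := PΨ * PZU - PU * PZΨ with hQ'
  have cQ'low : ∀ j, j < k → Q'.coeff j = 0 := by
    intro j hj
    rw [hQ', coeff_sub, hPΨ, hPZU, hPU, hPZΨ,
      coeff_mul_genPoly_of_vanish_le N j nZU nΨ (fun l hl => vZU l (lt_of_le_of_lt hl hj)),
      mul_comm, coeff_mul_genPoly_of_vanish_le N j nU nZΨ (fun l hl => vU l (lt_of_le_of_lt hl hj))]
    ring
  have c3 : (C 2 * X * Q').coeff k = 0 := by
    rw [mul_assoc, coeff_C_mul, coeff_X_mul_of_vanish cQ'low]; ring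
  have : P.coeff k = (1 - γ / 2 - k * γ) * U k Y +
      γ * (Y.1 * derivR (U k) Y + Y.2 * derivZ (U k) Y) +
      (-derivZ (Ψ 0) Y * derivR (U k) Y + derivR (Ψ 0) Y * derivZ (U k) Y) := by
    rw [hP, coeff_add, coeff_add, cA, c2, cQ, c3]; ring
  rw [← this]; exact hcoeff

/-- **The order-`k` vorticity equation (20k), with its coupling to the leading stream profile**
(read off after `U_l`, `l ≤ k`, are known to vanish near `Y`).
[cite: ChaeTsai2015, §3 (29), (3.5), (20k) (arXiv p. 5)] -/
theorem order_vorticity (hs₀ : 0 < s₀)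
    (hid : ∀ s ∈ Ioo 0 s₀,
      (∑ k ∈ Finset.range N, s ^ k * ((1 - k * γ) * Ω k Y)) +
        γ * (Y.1 * (∑ k ∈ Finset.range N, s ^ k * derivR (Ω k) Y) +
          Y.2 * (∑ k ∈ Finset.range N, s ^ k * derivZ (Ω k) Y)) +
        (-(∑ k ∈ Finset.range N, s ^ k * derivZ (Ψ k) Y) *
            (∑ k ∈ Finset.range N, s ^ k * derivR (Ω k) Y) +
          (∑ k ∈ Finset.range N, s ^ k * derivR (Ψ k) Y) *
            (∑ k ∈ Finset.range N, s ^ k * derivZ (Ω k) Y)) -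
        2 * (∑ k ∈ Finset.range N, s ^ k * U k Y) *
          (∑ k ∈ Finset.range N, s ^ k * derivZ (U k) Y) +
      s * (Y.1 * (-(∑ k ∈ Finset.range N, s ^ k * derivZ (Ψ k) Y) *
            (∑ k ∈ Finset.range N, s ^ k * derivR (Ω k) Y) +
          (∑ k ∈ Finset.range N, s ^ k * derivR (Ψ k) Y) *
            (∑ k ∈ Finset.range N, s ^ k * derivZ (Ω k) Y)) +
        2 * (∑ k ∈ Finset.range N, s ^ k * Ψ k Y) *
          (∑ k ∈ Finset.range N, s ^ k * derivZ (Ω k) Y)) = 0)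
    (k : ℕ) (hUN : ∀ l, N ≤ l → U l Y = 0 ∧ derivR (U l) Y = 0 ∧ derivZ (U l) Y = 0)
    (hΩN : ∀ l, N ≤ l → Ω l Y = 0 ∧ derivR (Ω l) Y = 0 ∧ derivZ (Ω l) Y = 0)
    (hΨN : ∀ l, N ≤ l → Ψ l Y = 0 ∧ derivR (Ψ l) Y = 0 ∧ derivZ (Ψ l) Y = 0)
    (hUk : ∀ l, l ≤ k → U l Y = 0 ∧ derivR (U l) Y = 0 ∧ derivZ (U l) Y = 0)
    (hΩk : ∀ l, l < k → Ω l Y = 0 ∧ derivR (Ω l) Y = 0 ∧ derivZ (Ω l) Y = 0) :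
    (1 - k * γ) * Ω k Y + γ * (Y.1 * derivR (Ω k) Y + Y.2 * derivZ (Ω k) Y) +
      (-derivZ (Ψ 0) Y * derivR (Ω k) Y + derivR (Ψ 0) Y * derivZ (Ω k) Y) = 0 := by
  set PU : ℝ[X] := ∑ l ∈ Finset.range N, monomial l (U l Y) with hPU
  set PZU : ℝ[X] := ∑ l ∈ Finset.range N, monomial l (derivZ (U l) Y) with hPZU
  set PRΩ : ℝ[X] := ∑ l ∈ Finset.range N, monomial l (derivR (Ω l) Y) with hPRΩ
  set PZΩ : ℝ[X] := ∑ l ∈ Finset.range N, monomial l (derivZ (Ω l) Y) with hPZΩ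
  set PΨ : ℝ[X] := ∑ l ∈ Finset.range N, monomial l (Ψ l Y) with hPΨ
  set PRΨ : ℝ[X] := ∑ l ∈ Finset.range N, monomial l (derivR (Ψ l) Y) with hPRΨ
  set PZΨ : ℝ[X] := ∑ l ∈ Finset.range N, monomial l (derivZ (Ψ l) Y) with hPZΨ
  set AΩ : ℝ[X] := ∑ l ∈ Finset.range N, monomial l ((1 - l * γ) * Ω l Y +
    γ * (Y.1 * derivR (Ω l) Y + Y.2 * derivZ (Ω l) Y)) with hAΩ
  set P : ℝ[X] := AΩ + (1 + C Y.1 * X) * (-PZΨ * PRΩ + PRΨ * PZΩ) - C 2 * (PU * PZU) +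
    C 2 * X * (PΨ * PZΩ) with hP
  have heval : ∀ s : ℝ, P.eval s =
      (∑ k ∈ Finset.range N, s ^ k * ((1 - k * γ) * Ω k Y)) +
        γ * (Y.1 * (∑ k ∈ Finset.range N, s ^ k * derivR (Ω k) Y) +
          Y.2 * (∑ k ∈ Finset.range N, s ^ k * derivZ (Ω k) Y)) +
        (-(∑ k ∈ Finset.range N, s ^ k * derivZ (Ψ k) Y) *
            (∑ k ∈ Finset.range N, s ^ k * derivR (Ω k) Y) +
          (∑ k ∈ Finset.range N, s ^ k * derivR (Ψ k) Y) *
            (∑ k ∈ Finset.range N, s ^ k * derivZ (Ω k) Y)) -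
        2 * (∑ k ∈ Finset.range N, s ^ k * U k Y) *
          (∑ k ∈ Finset.range N, s ^ k * derivZ (U k) Y) +
      s * (Y.1 * (-(∑ k ∈ Finset.range N, s ^ k * derivZ (Ψ k) Y) *
            (∑ k ∈ Finset.range N, s ^ k * derivR (Ω k) Y) +
          (∑ k ∈ Finset.range N, s ^ k * derivR (Ψ k) Y) *
            (∑ k ∈ Finset.range N, s ^ k * derivZ (Ω k) Y)) +
        2 * (∑ k ∈ Finset.range N, s ^ k * Ψ k Y) *
          (∑ k ∈ Finset.range N, s ^ k * derivZ (Ω k) Y)) := by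
    intro s
    have eA : AΩ.eval s = (1 : ℝ) * (∑ k ∈ Finset.range N, s ^ k * ((1 - k * γ) * Ω k Y)) +
        γ * Y.1 * (∑ k ∈ Finset.range N, s ^ k * derivR (Ω k) Y) +
        γ * Y.2 * (∑ k ∈ Finset.range N, s ^ k * derivZ (Ω k) Y) := by
      rw [hAΩ, eval_genPoly, ← sum_shape3]
      exact Finset.sum_congr rfl fun k _ => by ring
    simp only [hP, eval_add, eval_mul, eval_sub, eval_neg, eval_C, eval_X, eval_one,
      hPU, hPZU, hPRΩ, hPZΩ, hPΨ, hPRΨ, hPZΨ, eval_genPoly]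
    rw [eA]; ring
  have hP0 : P = 0 :=
    poly_eq_zero_of_eval_eq_zero_Ioo hs₀ fun s hs => by rw [heval s]; exact hid s hs
  have hcoeff : P.coeff k = 0 := by rw [hP0, coeff_zero]
  have vRΩ : ∀ l, l < k → derivR (Ω l) Y = 0 := fun l hl => (hΩk l hl).2.1
  have vZΩ : ∀ l, l < k → derivZ (Ω l) Y = 0 := fun l hl => (hΩk l hl).2.2
  have vZU : ∀ l, l ≤ k → derivZ (U l) Y = 0 := fun l hl => (hUk l hl).2.2
  have nU : ∀ l, N ≤ l → U l Y = 0 := fun l hl => (hUN l hl).1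
  have nZU : ∀ l, N ≤ l → derivZ (U l) Y = 0 := fun l hl => (hUN l hl).2.2
  have nΩ : ∀ l, N ≤ l → Ω l Y = 0 := fun l hl => (hΩN l hl).1
  have nRΩ : ∀ l, N ≤ l → derivR (Ω l) Y = 0 := fun l hl => (hΩN l hl).2.1
  have nZΩ : ∀ l, N ≤ l → derivZ (Ω l) Y = 0 := fun l hl => (hΩN l hl).2.2
  have nΨ : ∀ l, N ≤ l → Ψ l Y = 0 := fun l hl => (hΨN l hl).1
  have nRΨ : ∀ l, N ≤ l → derivR (Ψ l) Y = 0 := fun l hl => (hΨN l hl).2.1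
  have nZΨ : ∀ l, N ≤ l → derivZ (Ψ l) Y = 0 := fun l hl => (hΨN l hl).2.2
  have cA : AΩ.coeff k = (1 - k * γ) * Ω k Y +
      γ * (Y.1 * derivR (Ω k) Y + Y.2 * derivZ (Ω k) Y) := by
    rw [hAΩ, coeff_genPoly_of_vanish N]
    intro l hl
    rw [nΩ l hl, nRΩ l hl, nZΩ l hl]; ring
  set Q : ℝ[X] := -PZΨ * PRΩ + PRΨ * PZΩ with hQ
  have cQ : Q.coeff k = -(derivZ (Ψ 0) Y * derivR (Ω k) Y) + derivR (Ψ 0) Y * derivZ (Ω k) Y := by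
    rw [hQ, coeff_add, neg_mul, coeff_neg, hPZΨ, hPRΩ, hPRΨ, hPZΩ,
      coeff_mul_genPoly_of_vanish_lt N k nRΩ nZΨ vRΩ, coeff_mul_genPoly_of_vanish_lt N k nZΩ nRΨ vZΩ]
  have cQlow : ∀ j, j < k → Q.coeff j = 0 := by
    intro j hj
    rw [hQ, coeff_add, neg_mul, coeff_neg, hPZΨ, hPRΩ, hPRΨ, hPZΩ,
      coeff_mul_genPoly_of_vanish_le N j nRΩ nZΨ (fun l hl => vRΩ l (lt_of_le_of_lt hl hj)),
      coeff_mul_genPoly_of_vanish_le N j nZΩ nRΨ (fun l hl => vZΩ l (lt_of_le_of_lt hl hj))]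
    ring
  have c2 : ((1 + C Y.1 * X) * Q).coeff k = Q.coeff k := by
    rw [add_mul, one_mul, coeff_add, mul_assoc, coeff_C_mul, coeff_X_mul_of_vanish cQlow]; ring
  have c3 : (C 2 * (PU * PZU)).coeff k = 0 := by
    rw [coeff_C_mul, hPU, hPZU, coeff_mul_genPoly_of_vanish_le N k nZU nU vZU]; ring
  set Q' : ℝ[X] := PΨ * PZΩ with hQ'
  have cQ'low : ∀ j, j < k → Q'.coeff j = 0 := by
    intro j hj
    rw [hQ', hPΨ, hPZΩ,
      coeff_mul_genPoly_of_vanish_le N j nZΩ nΨ (fun l hl => vZΩ l (lt_of_le_of_lt hl hj))]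
  have c4 : (C 2 * X * Q').coeff k = 0 := by
    rw [mul_assoc, coeff_C_mul, coeff_X_mul_of_vanish cQ'low]; ring
  have : P.coeff k = (1 - k * γ) * Ω k Y +
      γ * (Y.1 * derivR (Ω k) Y + Y.2 * derivZ (Ω k) Y) +
      (-derivZ (Ψ 0) Y * derivR (Ω k) Y + derivR (Ψ 0) Y * derivZ (Ω k) Y) := by
    rw [hP, coeff_add, coeff_sub, coeff_add, cA, c2, cQ, c3, c4]; ring
  rw [← this]; exact hcoeff

/-- **The order-`0` and order-`k+1` stream equations (30), (3.6), (21k):**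
`−ΔΨ₀ = Ω₀` and `−ΔΨ_{k+1} − RΔΨ_k − 3∂_RΨ_k = Ω_{k+1} + RΩ_k` at `Y`.
[cite: ChaeTsai2015, §3 (30), (3.6), (21k) (arXiv p. 5)] -/
theorem order_stream (hs₀ : 0 < s₀)
    (hid : ∀ s ∈ Ioo 0 s₀,
      -(∑ k ∈ Finset.range N, s ^ k * (derivR (derivR (Ψ k)) Y + derivZ (derivZ (Ψ k)) Y)) -
        (∑ k ∈ Finset.range N, s ^ k * Ω k Y) +
      s * (-(Y.1 * (∑ k ∈ Finset.range N, s ^ k *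
          (derivR (derivR (Ψ k)) Y + derivZ (derivZ (Ψ k)) Y))) -
        3 * (∑ k ∈ Finset.range N, s ^ k * derivR (Ψ k) Y) -
        Y.1 * (∑ k ∈ Finset.range N, s ^ k * Ω k Y)) = 0)
    (hΩN : ∀ l, N ≤ l → Ω l Y = 0)
    (hΨN : ∀ l, N ≤ l → derivR (Ψ l) Y = 0 ∧
      derivR (derivR (Ψ l)) Y + derivZ (derivZ (Ψ l)) Y = 0) :
    (-(derivR (derivR (Ψ 0)) Y + derivZ (derivZ (Ψ 0)) Y) - Ω 0 Y = 0) ∧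
    ∀ k : ℕ, -(derivR (derivR (Ψ (k + 1))) Y + derivZ (derivZ (Ψ (k + 1))) Y) -
      Y.1 * (derivR (derivR (Ψ k)) Y + derivZ (derivZ (Ψ k)) Y) - 3 * derivR (Ψ k) Y -
      Ω (k + 1) Y - Y.1 * Ω k Y = 0 := by
  set PΔ : ℝ[X] := ∑ l ∈ Finset.range N,
    monomial l (derivR (derivR (Ψ l)) Y + derivZ (derivZ (Ψ l)) Y) with hPΔ
  set PRΨ : ℝ[X] := ∑ l ∈ Finset.range N, monomial l (derivR (Ψ l) Y) with hPRΨ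
  set PΩ : ℝ[X] := ∑ l ∈ Finset.range N, monomial l (Ω l Y) with hPΩ
  set P : ℝ[X] := -((1 + C Y.1 * X) * PΔ) - C 3 * X * PRΨ - (1 + C Y.1 * X) * PΩ with hP
  have heval : ∀ s : ℝ, P.eval s =
      -(∑ k ∈ Finset.range N, s ^ k * (derivR (derivR (Ψ k)) Y + derivZ (derivZ (Ψ k)) Y)) -
        (∑ k ∈ Finset.range N, s ^ k * Ω k Y) +
      s * (-(Y.1 * (∑ k ∈ Finset.range N, s ^ k *
          (derivR (derivR (Ψ k)) Y + derivZ (derivZ (Ψ k)) Y))) -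
        3 * (∑ k ∈ Finset.range N, s ^ k * derivR (Ψ k) Y) -
        Y.1 * (∑ k ∈ Finset.range N, s ^ k * Ω k Y)) := by
    intro s
    simp only [hP, eval_add, eval_mul, eval_sub, eval_neg, eval_C, eval_X, eval_one,
      hPΔ, hPRΨ, hPΩ, eval_genPoly]
    ring
  have hP0 : P = 0 :=
    poly_eq_zero_of_eval_eq_zero_Ioo hs₀ fun s hs => by rw [heval s]; exact hid s hs
  have nΔ : ∀ l, N ≤ l → derivR (derivR (Ψ l)) Y + derivZ (derivZ (Ψ l)) Y = 0 :=
    fun l hl => (hΨN l hl).2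
  have nR : ∀ l, N ≤ l → derivR (Ψ l) Y = 0 := fun l hl => (hΨN l hl).1
  have cΔ : ∀ m, PΔ.coeff m = derivR (derivR (Ψ m)) Y + derivZ (derivZ (Ψ m)) Y :=
    fun m => by rw [hPΔ, coeff_genPoly_of_vanish N nΔ]
  have cR : ∀ m, PRΨ.coeff m = derivR (Ψ m) Y := fun m => by rw [hPRΨ, coeff_genPoly_of_vanish N nR]
  have cΩ : ∀ m, PΩ.coeff m = Ω m Y := fun m => by rw [hPΩ, coeff_genPoly_of_vanish N hΩN]
  have expand : P = -PΔ - C Y.1 * (X * PΔ) - C 3 * (X * PRΨ) - PΩ - C Y.1 * (X * PΩ) := by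
    rw [hP]; ring
  constructor
  · have h0 : P.coeff 0 = 0 := by rw [hP0, coeff_zero]
    rw [expand] at h0
    simp only [coeff_sub, coeff_neg, coeff_C_mul, coeff_X_mul_zero, mul_zero, sub_zero] at h0
    rw [cΔ, cΩ] at h0
    linear_combination h0
  · intro k
    have hk : P.coeff (k + 1) = 0 := by rw [hP0, coeff_zero]
    rw [expand] at hk
    simp only [coeff_sub, coeff_neg, coeff_C_mul, coeff_X_mul] at hk
    rw [cΔ, cΔ, cR, cΩ, cΩ] at hk
    linear_combination hk

end Orders

/-! ### Theorem 2 -/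

section Main

open LuoHouAnsatz

variable {S : Set ℝ} {T γ δ : ℝ} {u₁ ω₁ ψ₁ : ℝ → ℝ × ℝ → ℝ} {U Ω Ψ : ℕ → ℝ × ℝ → ℝ}
  {O : Set (ℝ × ℝ)} {N : ℕ}

/-- The zero profile has vanishing partials of all orders used here. [folklore] -/
private theorem derivs_of_eq_zero {G : ℝ × ℝ → ℝ} (hG : G = 0) (Y : ℝ × ℝ) :
    G Y = 0 ∧ derivR G Y = 0 ∧ derivZ G Y = 0 ∧
      derivR (derivR G) Y = 0 ∧ derivZ (derivZ G) Y = 0 := by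
  have e : G = fun _ => (0 : ℝ) := hG
  subst e
  simp [derivR_const, derivZ_const]

/-- Admissible scales: every interior profile point is reached by all sufficiently small scales.
[folklore] -/
private theorem exists_scales (hγ : 0 < γ) (hδ : 0 < δ) (Y : ℝ × ℝ) :
    ∃ s₀ : ℝ, 0 < s₀ ∧ ∀ s ∈ Ioo 0 s₀,
      0 < s ∧ s ^ γ⁻¹ < δ ∧ s * |Y.1| < min δ 1 ∧ s * |Y.2| < δ := by
  set A : ℝ := |Y.1| + |Y.2| + 1 with hA
  have hApos : 0 < A := by rw [hA]; positivity
  have hm : 0 < min δ 1 := lt_min hδ one_pos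
  refine ⟨min (δ ^ γ) (min δ 1 / A), lt_min (Real.rpow_pos_of_pos hδ γ) (div_pos hm hApos),
    fun s hs => ?_⟩
  obtain ⟨hs0, hs1⟩ := hs
  have hsγ : s < δ ^ γ := lt_of_lt_of_le hs1 (min_le_left _ _)
  have hsA : s < min δ 1 / A := lt_of_lt_of_le hs1 (min_le_right _ _)
  have hsA' : s * A < min δ 1 := by rwa [lt_div_iff₀ hApos] at hsA
  refine ⟨hs0, ?_, ?_, ?_⟩
  · have h := Real.rpow_lt_rpow hs0.le hsγ (inv_pos.2 hγ)
    rwa [← Real.rpow_mul hδ.le, mul_inv_cancel₀ hγ.ne', Real.rpow_one] at h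
  · have : s * |Y.1| ≤ s * A := by
      apply mul_le_mul_of_nonneg_left _ hs0.le; rw [hA]; linarith [abs_nonneg Y.2]
    linarith
  · have : s * |Y.2| ≤ s * A := by
      apply mul_le_mul_of_nonneg_left _ hs0.le; rw [hA]; linarith [abs_nonneg Y.1]
    linarith [min_le_left δ 1]

/-- **Chae–Tsai 2015, Theorem 2 (generalized self-similar ansatz), finite order, `γ ≠ 2`, on
`𝒞_{δ,T}`.** Let `(u₁, ω₁, ψ₁)` solve the `(u₁, ω₁, ψ₁)`-form (01)–(03) of the axisymmetric Euler
equations (`GeneralizedAxisymNS S 3 0`) on `𝒞_{δ,T} = {1−δ < r < 1, |z| < δ, T−δ < t < T}` and have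
there the representation (11k)–(13k)
`u₁ = (T−t)^{−1+γ/2} Σ_{k<N} (T−t)^{kγ} U_k(R,Z)`, `ω₁ = (T−t)^{−1} Σ_{k<N} (T−t)^{kγ} Ω_k(R,Z)`,
`ψ₁ = (T−t)^{−1+2γ} Σ_{k<N} (T−t)^{kγ} Ψ_k(R,Z)`, `R = (r−1)/(T−t)^γ`, `Z = z/(T−t)^γ`, with
`0 < γ`, `γ ≠ 2`, profiles `U_k, Ω_k ∈ C¹`, `Ψ_k ∈ C²` on an open neighbourhood of the closed
half-plane `𝒟̄ = {R ≤ 0}` (indexed by all `k`, zero from `N` on), the decay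
`|U_k(Y)| + |Ω_k(Y)| = o(1)`, `|∇Ψ_k(Y)| = o(|Y|)` on `𝒟̄`, and the wall condition
`∂_ZΨ_k|_{R=0} = 0` (from `u^r = 0` at `r = 1`). Then every `U_k`, `Ω_k` vanishes on `𝒟̄`, every
`Ψ_k` is constant there, and consequently `u₁ = ω₁ = 0` and `∇ψ₁ = 0` on `𝒞_{δ,T}`.
Deviations from print, all disclosed: finitely many orders instead of a formal series; `γ ≠ 2`
and NO integrability hypothesis (3.10) (print needs (3.10) only at resonant orders; here the
resonant orders `k ≥ 1` are settled by a ray argument and the only remaining resonance, `γ = 2`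
at order `0`, is excluded — `TODO(general form)`); `C¹/C²` on a neighbourhood of `𝒟̄` for
print's `C¹_loc(𝒟̄)`; print's step "`Ψ₀ = aR + b`. By (UOPsi-infty), `a = 0`" does not follow
from `|∇Ψ₀| = o(|Y|)` and is replaced by the next-order stream equation
`−ΔΨ_{k+1} − RΔΨ_k − 3∂_RΨ_k = Ω_{k+1} + RΩ_k` together with `|∇Ψ_{k+1}| = o(|Y|)`
(`stream_affine_of_wall_of_sublinearGradient`); the window `𝒲_{δ(t)}` is not typed.
[cite: ChaeTsai2015, §3 Theorem 2 with (11k)–(13k), (UOPsi-infty), (Psi-BC) (arXiv p. 5) and its proof (p. 5–6)] -/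
theorem chaeTsai2015_seriesAnsatz_trivial (hγ : 0 < γ) (hγ2 : γ ≠ 2) (hδ : 0 < δ)
    (hS : Ioo (T - δ) T ⊆ S) (hO : IsOpen O) (hHO : {Y : ℝ × ℝ | Y.1 ≤ 0} ⊆ O)
    (hU : ∀ k, ContDiffOn ℝ 1 (U k) O) (hΩ : ∀ k, ContDiffOn ℝ 1 (Ω k) O)
    (hΨ : ∀ k, ContDiffOn ℝ 2 (Ψ k) O)
    (hN : ∀ k, N ≤ k → U k = 0 ∧ Ω k = 0 ∧ Ψ k = 0)
    (hE : ∀ t ∈ Ioo (T - δ) T, ∀ q : ℝ × ℝ, 1 - δ < q.1 → q.1 < 1 → |q.2| < δ →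
      GeneralizedAxisymNS S 3 0 u₁ ω₁ ψ₁ t q)
    (hu : ∀ t ∈ Ioo (T - δ) T, ∀ q : ℝ × ℝ, 1 - δ < q.1 → q.1 < 1 → |q.2| < δ →
      u₁ t q = (T - t) ^ (-1 + γ / 2) * ∑ k ∈ Finset.range N,
        ((T - t) ^ γ) ^ k * U k ((q.1 - 1) / (T - t) ^ γ, q.2 / (T - t) ^ γ))
    (hω : ∀ t ∈ Ioo (T - δ) T, ∀ q : ℝ × ℝ, 1 - δ < q.1 → q.1 < 1 → |q.2| < δ →
      ω₁ t q = (T - t)⁻¹ * ∑ k ∈ Finset.range N,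
        ((T - t) ^ γ) ^ k * Ω k ((q.1 - 1) / (T - t) ^ γ, q.2 / (T - t) ^ γ))
    (hψ : ∀ t ∈ Ioo (T - δ) T, ∀ q : ℝ × ℝ, 1 - δ < q.1 → q.1 < 1 → |q.2| < δ →
      ψ₁ t q = (T - t) ^ (-1 + 2 * γ) * ∑ k ∈ Finset.range N,
        ((T - t) ^ γ) ^ k * Ψ k ((q.1 - 1) / (T - t) ^ γ, q.2 / (T - t) ^ γ))
    (hdecay : ∀ k, ∀ ε : ℝ, 0 < ε → ∃ M : ℝ, ∀ Y : ℝ × ℝ, Y.1 ≤ 0 → M ≤ ‖Y‖ →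
      |U k Y| + |Ω k Y| < ε)
    (hgrad : ∀ k, ∀ ε : ℝ, 0 < ε → ∃ M : ℝ, ∀ Y : ℝ × ℝ, Y.1 ≤ 0 → M ≤ ‖Y‖ →
      |derivR (Ψ k) Y| + |derivZ (Ψ k) Y| ≤ ε * ‖Y‖)
    (hwall : ∀ k (Z : ℝ), derivZ (Ψ k) (0, Z) = 0) :
    (∀ k, ∃ b : ℝ, ∀ Y : ℝ × ℝ, Y.1 ≤ 0 →
      U k Y = 0 ∧ Ω k Y = 0 ∧ Ψ k Y = b ∧ derivR (Ψ k) Y = 0 ∧ derivZ (Ψ k) Y = 0) ∧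
    (∀ t ∈ Ioo (T - δ) T, ∀ q : ℝ × ℝ, 1 - δ < q.1 → q.1 < 1 → |q.2| < δ →
      u₁ t q = 0 ∧ ω₁ t q = 0 ∧ derivR (ψ₁ t) q = 0 ∧ derivZ (ψ₁ t) q = 0) := by
  -- profiles beyond the order bound
  have zU : ∀ l, N ≤ l → ∀ Y : ℝ × ℝ, U l Y = 0 ∧ derivR (U l) Y = 0 ∧ derivZ (U l) Y = 0 :=
    fun l hl Y => let h := derivs_of_eq_zero (hN l hl).1 Y; ⟨h.1, h.2.1, h.2.2.1⟩
  have zΩ : ∀ l, N ≤ l → ∀ Y : ℝ × ℝ, Ω l Y = 0 ∧ derivR (Ω l) Y = 0 ∧ derivZ (Ω l) Y = 0 :=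
    fun l hl Y => let h := derivs_of_eq_zero (hN l hl).2.1 Y; ⟨h.1, h.2.1, h.2.2.1⟩
  have zΨ : ∀ l, N ≤ l → ∀ Y : ℝ × ℝ, Ψ l Y = 0 ∧ derivR (Ψ l) Y = 0 ∧ derivZ (Ψ l) Y = 0 :=
    fun l hl Y => let h := derivs_of_eq_zero (hN l hl).2.2 Y; ⟨h.1, h.2.1, h.2.2.1⟩
  have zΨ2 : ∀ l, N ≤ l → ∀ Y : ℝ × ℝ, derivR (Ψ l) Y = 0 ∧
      derivR (derivR (Ψ l)) Y + derivZ (derivZ (Ψ l)) Y = 0 :=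
    fun l hl Y => let h := derivs_of_eq_zero (hN l hl).2.2 Y; ⟨h.2.1, by rw [h.2.2.2.1, h.2.2.2.2, add_zero]⟩
  -- decay of the individual families
  have decU : ∀ k, ∀ ε : ℝ, 0 < ε → ∃ M : ℝ, ∀ Y : ℝ × ℝ, Y.1 ≤ 0 → M ≤ ‖Y‖ → |U k Y| < ε := by
    intro k ε hε
    obtain ⟨M, hM⟩ := hdecay k ε hε
    exact ⟨M, fun Y hY hM' => by have := hM Y hY hM'; linarith [abs_nonneg (Ω k Y)]⟩
  have decΩ : ∀ k, ∀ ε : ℝ, 0 < ε → ∃ M : ℝ, ∀ Y : ℝ × ℝ, Y.1 ≤ 0 → M ≤ ‖Y‖ → |Ω k Y| < ε := by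
    intro k ε hε
    obtain ⟨M, hM⟩ := hdecay k ε hε
    exact ⟨M, fun Y hY hM' => by have := hM Y hY hM'; linarith [abs_nonneg (U k Y)]⟩
  -- the generating identities at every interior profile point
  have hgen := fun (Y : ℝ × ℝ) (hY1 : Y.1 < 0) (s : ℝ) (hs : 0 < s) (h1 : s ^ γ⁻¹ < δ)
    (h2 : s * |Y.1| < min δ 1) (h3 : s * |Y.2| < δ) =>
    series_substitution_at_scale hγ hS hO hHO hU hΩ hΨ hE hu hω hψ hY1 hs h1 h2 h3
  -- the leading stream field `W = ∇⊥Ψ₀` of the maximum principle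
  have hW₁ : ContinuousOn (fun Y => -derivZ (Ψ 0) Y) O :=
    (continuousOn_derivZ_open ((hΨ 0).of_le one_le_two) hO).neg
  have hW₂ : ContinuousOn (derivR (Ψ 0)) O := continuousOn_derivR_open ((hΨ 0).of_le one_le_two) hO
  have hW₁wall : ∀ Z : ℝ, (fun Y => -derivZ (Ψ 0) Y) (0, Z) = 0 := fun Z => by
    simp only [hwall 0 Z, neg_zero]
  -- THE INDUCTION ON THE ORDER
  have main : ∀ k : ℕ, ∀ l, l < k →
      (∀ Y : ℝ × ℝ, Y.1 ≤ 0 → U l Y = 0 ∧ Ω l Y = 0) ∧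
      ∃ a b : ℝ, (∀ Y : ℝ × ℝ, Y.1 ≤ 0 →
        Ψ l Y = a * Y.1 + b ∧ derivR (Ψ l) Y = a ∧ derivZ (Ψ l) Y = 0) ∧ (l + 1 < k → a = 0) := by
    intro k
    induction k with
    | zero => intro l hl; exact absurd hl (Nat.not_lt_zero l)
    | succ k ih =>
      -- data below order `k`
      have hUl : ∀ l, l < k → ∀ Y : ℝ × ℝ, Y.1 ≤ 0 → U l Y = 0 :=
        fun l hl Y hY => ((ih l hl).1 Y hY).1
      have hΩl : ∀ l, l < k → ∀ Y : ℝ × ℝ, Y.1 ≤ 0 → Ω l Y = 0 :=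
        fun l hl Y hY => ((ih l hl).1 Y hY).2
      have vU : ∀ l, l < k → ∀ Y : ℝ × ℝ, Y.1 ≤ 0 →
          U l Y = 0 ∧ derivR (U l) Y = 0 ∧ derivZ (U l) Y = 0 := fun l hl Y hY =>
        ⟨hUl l hl Y hY, derivR_derivZ_eq_zero_of_eq_zero hO hHO (hU l) (hUl l hl) hY⟩
      have vΩ : ∀ l, l < k → ∀ Y : ℝ × ℝ, Y.1 ≤ 0 →
          Ω l Y = 0 ∧ derivR (Ω l) Y = 0 ∧ derivZ (Ω l) Y = 0 := fun l hl Y hY =>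
        ⟨hΩl l hl Y hY, derivR_derivZ_eq_zero_of_eq_zero hO hHO (hΩ l) (hΩl l hl) hY⟩
      -- at a resonant order, `k ≥ 1` and the leading stream profile is affine
      have hres : ∀ c : ℝ, c = 0 → (c = 1 - γ / 2 - k * γ ∨ c = 1 - k * γ) →
          ∃ a₀ : ℝ, ∀ Y : ℝ × ℝ, Y.1 ≤ 0 → derivR (Ψ 0) Y = a₀ ∧ derivZ (Ψ 0) Y = 0 := by
        intro c hc hform
        have hk : 0 < k := by
          rcases Nat.eq_zero_or_pos k with h0 | h0
          · exfalso
            rw [h0] at hform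
            rcases hform with h | h
            · apply hγ2; rw [hc] at h; push_cast at h; linarith
            · rw [hc] at h; push_cast at h; linarith
          · exact h0
        obtain ⟨_, a₀, b₀, hΨ0, _⟩ := ih 0 hk
        exact ⟨a₀, fun Y hY => ⟨(hΨ0 Y hY).2.1, (hΨ0 Y hY).2.2⟩⟩
      -- from an affine leading stream profile, the transport field is radial from a wall point
      have hray : ∀ (G : ℝ × ℝ → ℝ) (a₀ : ℝ),
          (∀ Y : ℝ × ℝ, Y.1 ≤ 0 → derivR (Ψ 0) Y = a₀ ∧ derivZ (Ψ 0) Y = 0) →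
          (∀ Y : ℝ × ℝ, Y.1 < 0 → (0 : ℝ) * G Y + γ * (Y.1 * derivR G Y + Y.2 * derivZ G Y) +
            (-derivZ (Ψ 0) Y * derivR G Y + derivR (Ψ 0) Y * derivZ G Y) = 0) →
          ∀ Y : ℝ × ℝ, Y.1 < 0 → Y.1 * derivR G Y + (Y.2 - (-a₀ / γ)) * derivZ G Y = 0 := by
        intro G a₀ hΨ0 heq Y hY
        have e := heq Y hY
        rw [(hΨ0 Y hY.le).1, (hΨ0 Y hY.le).2] at e
        have h' : γ * (Y.1 * derivR G Y + Y.2 * derivZ G Y) + a₀ * derivZ G Y = 0 := by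
          linear_combination e
        have : Y.1 * derivR G Y + (Y.2 - (-a₀ / γ)) * derivZ G Y =
            γ⁻¹ * (γ * (Y.1 * derivR G Y + Y.2 * derivZ G Y) + a₀ * derivZ G Y) := by
          field_simp
          ring
        rw [this, h', mul_zero]
      -- STEP 1: `U_k ≡ 0`
      have hUk : ∀ Y : ℝ × ℝ, Y.1 ≤ 0 → U k Y = 0 := by
        have hred : ∀ Y : ℝ × ℝ, Y.1 < 0 → (1 - γ / 2 - k * γ) * U k Y +
            γ * (Y.1 * derivR (U k) Y + Y.2 * derivZ (U k) Y) +
            (-derivZ (Ψ 0) Y * derivR (U k) Y + derivR (Ψ 0) Y * derivZ (U k) Y) = 0 := by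
          intro Y hY
          obtain ⟨s₀, hs₀, hsc⟩ := exists_scales hγ hδ Y
          refine order_swirl hs₀ (fun s hs => ?_) k (fun l hl => zU l hl Y) (fun l hl => zΨ l hl Y)
            (fun l hl => vU l hl Y hY.le)
          obtain ⟨h0, h1, h2, h3⟩ := hsc s hs
          exact (hgen Y hY s h0 h1 h2 h3).1
        by_cases hc : 1 - γ / 2 - k * γ = 0
        · obtain ⟨a₀, hΨ0⟩ := hres _ hc (Or.inl rfl)
          refine eq_zero_of_rayTransport hO hHO (hU k) (hray (U k) a₀ hΨ0 fun Y hY => ?_) (decU k)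
          have e := hred Y hY
          rw [hc] at e
          exact e
        · exact eq_zero_of_transport_wall_maxPrinciple hO hHO hc (hU k) hW₁ hW₂ hW₁wall hred (decU k)
      have vUk : ∀ l, l ≤ k → ∀ Y : ℝ × ℝ, Y.1 ≤ 0 →
          U l Y = 0 ∧ derivR (U l) Y = 0 ∧ derivZ (U l) Y = 0 := by
        intro l hl Y hY
        rcases hl.lt_or_eq with hlt | heq
        · exact vU l hlt Y hY
        · rw [heq]
          exact ⟨hUk Y hY, derivR_derivZ_eq_zero_of_eq_zero hO hHO (hU k) hUk hY⟩
      -- STEP 2: `Ω_k ≡ 0`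
      have hΩk : ∀ Y : ℝ × ℝ, Y.1 ≤ 0 → Ω k Y = 0 := by
        have hred : ∀ Y : ℝ × ℝ, Y.1 < 0 → (1 - k * γ) * Ω k Y +
            γ * (Y.1 * derivR (Ω k) Y + Y.2 * derivZ (Ω k) Y) +
            (-derivZ (Ψ 0) Y * derivR (Ω k) Y + derivR (Ψ 0) Y * derivZ (Ω k) Y) = 0 := by
          intro Y hY
          obtain ⟨s₀, hs₀, hsc⟩ := exists_scales hγ hδ Y
          refine order_vorticity hs₀ (fun s hs => ?_) k (fun l hl => zU l hl Y)
            (fun l hl => zΩ l hl Y) (fun l hl => zΨ l hl Y) (fun l hl => vUk l hl Y hY.le)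
            (fun l hl => vΩ l hl Y hY.le)
          obtain ⟨h0, h1, h2, h3⟩ := hsc s hs
          exact (hgen Y hY s h0 h1 h2 h3).2.1
        by_cases hc : 1 - k * γ = 0
        · obtain ⟨a₀, hΨ0⟩ := hres _ hc (Or.inr rfl)
          refine eq_zero_of_rayTransport hO hHO (hΩ k) (hray (Ω k) a₀ hΨ0 fun Y hY => ?_) (decΩ k)
          have e := hred Y hY
          rw [hc] at e
          exact e
        · exact eq_zero_of_transport_wall_maxPrinciple hO hHO hc (hΩ k) hW₁ hW₂ hW₁wall hred (decΩ k)
      -- STEP 3: the stream profile `Ψ_k`: constant Laplacian `κ`, then engine B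
      have hopen : IsOpen {q : ℝ × ℝ | q.1 < 0} := isOpen_lt continuous_fst continuous_const
      have hstream : ∀ Y : ℝ × ℝ, Y.1 < 0 →
          (-(derivR (derivR (Ψ 0)) Y + derivZ (derivZ (Ψ 0)) Y) - Ω 0 Y = 0) ∧
          ∀ m : ℕ, -(derivR (derivR (Ψ (m + 1))) Y + derivZ (derivZ (Ψ (m + 1))) Y) -
            Y.1 * (derivR (derivR (Ψ m)) Y + derivZ (derivZ (Ψ m)) Y) - 3 * derivR (Ψ m) Y -
            Ω (m + 1) Y - Y.1 * Ω m Y = 0 := by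
        intro Y hY
        obtain ⟨s₀, hs₀, hsc⟩ := exists_scales hγ hδ Y
        exact order_stream hs₀ (fun s hs => by
          obtain ⟨h0, h1, h2, h3⟩ := hsc s hs
          exact (hgen Y hY s h0 h1 h2 h3).2.2) (fun l hl => (zΩ l hl Y).1) (fun l hl => zΨ2 l hl Y)
      -- `κ` and the previous slope
      obtain ⟨κ, aprev, hκa, hprev, hpoisson⟩ : ∃ κ aprev : ℝ, κ = -3 * aprev ∧
          (∀ k', k = k' + 1 → ∀ Y : ℝ × ℝ, Y.1 ≤ 0 → derivR (Ψ k') Y = aprev) ∧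
          ∀ Y : ℝ × ℝ, Y.1 < 0 → derivR (derivR (Ψ k)) Y + derivZ (derivZ (Ψ k)) Y = κ := by
        cases k with
        | zero =>
          refine ⟨0, 0, by ring, fun k' hk' => absurd hk' (by omega), fun Y hY => ?_⟩
          have h := (hstream Y hY).1
          rw [hΩk Y hY.le] at h
          linear_combination -h
        | succ k' =>
          obtain ⟨_, a', b', hΨ', _⟩ := ih k' (Nat.lt_succ_self k')
          refine ⟨-3 * a', a', rfl, fun k'' hk'' Y hY => ?_, fun Y hY => ?_⟩
          · have : k'' = k' := by omega
            subst this
            exact (hΨ' Y hY).2.1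
          · have h := (hstream Y hY).2 k'
            -- `ΔΨ_{k'} = 0` on the open half-plane: its partials are locally constant there
            have hRR : derivR (derivR (Ψ k')) Y = 0 := by
              have hev : derivR (Ψ k') =ᶠ[𝓝 Y] fun _ => a' := by
                filter_upwards [hopen.mem_nhds hY] with q hq
                exact (hΨ' q (le_of_lt hq)).2.1
              rw [derivR_congr_nhds hev, derivR_const]
            have hZZ : derivZ (derivZ (Ψ k')) Y = 0 := by
              have hev : derivZ (Ψ k') =ᶠ[𝓝 Y] fun _ => (0 : ℝ) := by
                filter_upwards [hopen.mem_nhds hY] with q hq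
                exact (hΨ' q (le_of_lt hq)).2.2
              rw [derivZ_congr_nhds hev, derivZ_const]
            rw [hRR, hZZ, (hΨ' Y hY.le).2.1, hΩk Y hY.le, hΩl k' (Nat.lt_succ_self k') Y hY.le] at h
            linear_combination -h
      obtain ⟨hκ0, a, b, hΨk⟩ := stream_affine_of_wall_of_sublinearGradient hO hHO (hΨ k) (hwall k)
        hpoisson (hgrad k)
      have haprev : ∀ k', k = k' + 1 → aprev = 0 := by
        intro k' hk'
        have h3 : -3 * aprev = 0 := by rw [← hκa]; exact hκ0
        linarith
      -- packaging order `k + 1`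
      intro l hl
      by_cases hlk : l < k
      · obtain ⟨hUΩ, a₁, b₁, hΨ₁, himp⟩ := ih l hlk
        refine ⟨hUΩ, a₁, b₁, hΨ₁, fun hl1 => ?_⟩
        by_cases hl2 : l + 1 < k
        · exact himp hl2
        · have hkl : k = l + 1 := by omega
          have e1 := (hΨ₁ (0, 0) le_rfl).2.1
          have e2 := hprev l hkl (0, 0) le_rfl
          rw [← e1, e2]
          exact haprev l hkl
      · have hlk' : l = k := by omega
        subst hlk'
        exact ⟨fun Y hY => ⟨hUk Y hY, hΩk Y hY⟩, a, b, hΨk, fun h => absurd h (lt_irrefl _)⟩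
  -- CONSEQUENCES for the profiles
  have prof : ∀ k, ∃ b : ℝ, ∀ Y : ℝ × ℝ, Y.1 ≤ 0 →
      U k Y = 0 ∧ Ω k Y = 0 ∧ Ψ k Y = b ∧ derivR (Ψ k) Y = 0 ∧ derivZ (Ψ k) Y = 0 := by
    intro k
    obtain ⟨hUΩ, a, b, hΨk, himp⟩ := main (k + 2) k (by omega)
    have ha : a = 0 := himp (by omega)
    refine ⟨b, fun Y hY => ⟨(hUΩ Y hY).1, (hUΩ Y hY).2, ?_, ?_, (hΨk Y hY).2.2⟩⟩
    · rw [(hΨk Y hY).1, ha]; ring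
    · rw [(hΨk Y hY).2.1, ha]
  refine ⟨prof, fun t ht q hq1 hq2 hq3 => ?_⟩
  -- CONSEQUENCES for the fields on the region
  choose b hb using prof
  have hτ : 0 < T - t := sub_pos.2 ht.2
  have hsp : 0 < (T - t) ^ γ := Real.rpow_pos_of_pos hτ γ
  have hYneg : ∀ q' : ℝ × ℝ, q'.1 < 1 → ((q'.1 - 1) / (T - t) ^ γ, q'.2 / (T - t) ^ γ).1 ≤ 0 :=
    fun q' hq' => by simp only; exact div_nonpos_of_nonpos_of_nonneg (by linarith) hsp.le
  have hreg : ∀ᶠ q' : ℝ × ℝ in 𝓝 q, 1 - δ < q'.1 ∧ q'.1 < 1 ∧ |q'.2| < δ := by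
    have ho : IsOpen {q' : ℝ × ℝ | 1 - δ < q'.1 ∧ q'.1 < 1 ∧ |q'.2| < δ} :=
      (isOpen_lt continuous_const continuous_fst).inter
        ((isOpen_lt continuous_fst continuous_const).inter
          (isOpen_lt (continuous_abs.comp continuous_snd) continuous_const))
    exact ho.mem_nhds ⟨hq1, hq2, hq3⟩
  have hψconst : ψ₁ t =ᶠ[𝓝 q] fun _ =>
      (T - t) ^ (-1 + 2 * γ) * ∑ k ∈ Finset.range N, ((T - t) ^ γ) ^ k * b k := by
    filter_upwards [hreg] with q' hq'
    rw [hψ t ht q' hq'.1 hq'.2.1 hq'.2.2]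
    congr 1
    refine Finset.sum_congr rfl fun k _ => ?_
    rw [((hb k) _ (hYneg q' hq'.2.1)).2.2.1]
  refine ⟨?_, ?_, ?_, ?_⟩
  · rw [hu t ht q hq1 hq2 hq3]
    have : ∑ k ∈ Finset.range N, ((T - t) ^ γ) ^ k *
        U k ((q.1 - 1) / (T - t) ^ γ, q.2 / (T - t) ^ γ) = 0 :=
      Finset.sum_eq_zero fun k _ => by rw [((hb k) _ (hYneg q hq2)).1, mul_zero]
    rw [this, mul_zero]
  · rw [hω t ht q hq1 hq2 hq3]
    have : ∑ k ∈ Finset.range N, ((T - t) ^ γ) ^ k *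
        Ω k ((q.1 - 1) / (T - t) ^ γ, q.2 / (T - t) ^ γ) = 0 :=
      Finset.sum_eq_zero fun k _ => by rw [((hb k) _ (hYneg q hq2)).2.1, mul_zero]
    rw [this, mul_zero]
  · rw [derivR_congr_nhds hψconst, derivR_const]
  · rw [derivZ_congr_nhds hψconst, derivZ_const]

end Main

end LuoHouSeries

end Literature.Analysis.FluidPDE

end
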